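import Literature.MathematicalPhysics.QuantumFieldTheory.Balaban1983to89.Beta.RemainderConstCertified
import Literature.MathematicalPhysics.QuantumFieldTheory.Balaban1983to89.Beta.AveragedAFCarrier

/-!
# Beta / AveragedAFCarrierCertified — the THREE-LANE certified road (asym2 `RemainderConstCertified`) ON THE [III] SIDE:
# the carrier `BetaAvgAFH`, the whole located [III] list, and the T⁴ cell's flow-fact binders from {rate} × {one certified value} ×
# {constant-form remainder} (β sub-cell, [III]-side CO-LEAD unit `b2b-balaban-strat-b14` gen 15; BETA-SPEC §5.19 / §5.21; RULING (R15))
# v1.1 (same gen, APPEND-ONLY): + §4 the MARGIN × CONSTANT-REMAINDER road (asym1 `RateCertificate` §7 margin form × asym2's constant form) on the [III] side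
# v1.2 (gen 16, APPEND-ONLY, no new import): + §5 the REAL-ZONE × CONSTANT and BLOCK-TRANSFER × CONSTANT roads (asym1 `RateCertificate` §9/§10 ×
# asym2 `RemainderConstCertified` v1.2 §8, p185035) on the [III] side
# v1.3 (gen 16, APPEND-ONLY, no new import): + §6 the NEAR-SEQUENCE TRANSFER × CONSTANT roads (asym1 `RateCertificate` v1.7 §11 `NearRate` × asym2
# `RemainderConstCertified` v1.3 §9, p185430) on the [III] side
# v1.4 (gen 17, APPEND-ONLY, no new import): + §7 the CUMULATIVE (PARTIAL-SUM) SCHEME / L-TRANSFER DEFECT × CONSTANT roads (asym2 `RemainderConstCertified`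
# v1.4 §10 `CumNear`, p185869; RULING (R19) «L-transfer ⊂ (D1)») and §8 the EVENTUAL RATE × CONSTANT road (asym1 `RateCertificate` v1.8 §12 `EvGeomRate` ×
# asym2 v1.4 §11) on the [III] side

HONEST FRAMING (page 1 of everything the β sub-cell writes): discharging `BetaPertH` makes Bałaban's UV stability UNCONDITIONAL — a
real constructive-QFT result; it is NOT the continuum limit and NOT the Clay problem.  THIS MODULE is CLASS-LEVEL BOOKKEEPING: it
composes two LANDED kernel files — asym2's `RemainderConstCertified` v1r1 (p184438; the three-lane assembly in the CONSTANT-form remainder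
socket: (asym) `GeomRate S.β0 binf c₀ θ` × (cap) one certified lower value `m ≤ β⁰_{k₁+1}` + an index `k₂` × (asym2/an4)
`RemainderConst S γ₀ r`) and this lineage's `AveragedAFCarrier` v1.8 (p184099; the carrier `BetaAvgAFH` and its consumers) — exactly as
asym2's hand-off asks (journal NOTE 2026-08-19T07:04:21Z → strat-b14: «averaged-AF from the same three lanes =
`AveragedAFCarrier.betaAvgAFH_of_eventualForm (eventualFormOfCertifiedConst …)` by composition (b = 3(m − c₀θ^{k₁})/4 − r, k₀ = k₂)»;
`BETA/ASYM2.md` v1.3/v1.4 §9.4).  It asserts nothing printed by Bałaban; every statement is [folklore] bookkeeping over the cell's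
hypothesis carriers and computational leaves.  The wall (BETA-SPEC §7.20 (T) / §7.31, `BETA/WALL.md` v1.6) is UNTOUCHED; road-(1)
verdict unchanged (PRECISELY WALLED at END-STATEMENT grade; nothing of (M2⁺) discharged); value = the (R15-3) END-statement
bookkeeping for the certified road, NOT summit progress.

ABSOLUTE RULE (cell charter, verbatim): "No internally-minted statement may enter as a cited fact. Every hypothesis is either
kernel-proved in this package or a verbatim quotation of a PUBLISHED theorem with page reference. The manuscript(s) under audit are
NOT citable for their own disputed steps — they are the thing under adjudication; programme-internal (2001/route/tribunal) claims
are never citable."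

## What the binders are (RULING (R15-1)/(R15-2); `RemainderConstCertified` header «STILL OPEN … precisely»)

* `hconv : GeomRate S.β0 binf c₀ θ` (`0 ≤ θ ≤ 1`, `binf` ANY real — its sign is never assumed) — the asymptotic lane's RATE (AF-0r): the
  wall's (D1)+(D3) in rate clothing (cell item O-asym1-1), NOT a lane output;
* `hcert : m ≤ S.β0 k₁`, `hk₂ : c₀θ^{k₂} ≤ (m − c₀θ^{k₁})/4`, and (list forms only) `hsmall : ∀ k < k₂, m₀ ≤ S.β0 k` — the
  computer-assisted lane's COMPUTATIONAL LEAVES (certified enclosures; none is in the tree for Bałaban's split; referee item R-cap-8);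
* `hrem : RemainderConst S γ₀ r` with `r ≤ 3(m − c₀θ^{k₁})/4` (slope ≥ 0: endpoint existence, (2.6)–(2.9), C19/C20) resp. `r < …`
  STRICTLY (slope > 0: + (2.46)/C8, C13, C14; `ConstRemainderConsumers.Margin.sum246_fails` at equality) — wall item (D4) (the chain's
  leaves: [Balaban1988RG2Cluster] Lemma 3 (2.38) p. 20 etc., by name);
* `hlo : ∀ k, ∀ v ∈ Box γ₀ k, −β′ ≤ β k v`, `hup : BetaUpperH β′ γ₀ β` — the printed two-sided bound ([Balaban1987RG1] p. 264 with
  (5.10)) as binders; `hcont : BetaContH γ₀ β` — (C), wall item (D5); `hgen`/`hhalt`/`hcur` + `0 < β₀`, `L ≥ 2`, `p`, `κ₀ ≥ 6` —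
  structural / run-side data of the [III] consumers.
NOTHING ELSE: no `0 < β⁰_∞`, no identification `β⁰_∞ = stepBal N L`, no (AF-1), no `hident`, no γ-shrinking.  Table 9.1 of MISSING-B14 §9
gains no new row: the certified road IS the Gloss-2 row `EventualForm` ⟼ (b, (b+β′)k₀) with `b = 3(m − c₀θ^{k₁})/4 − r`, `k₀ = k₂`
(§1), resp. the (AF-0s) row (min m₀ (3(m − c₀θ^{k₁})/4) − r, 0) with the list (§1).

## Contents

§1 THE CARRIER: `betaAvgAFH_of_certifiedConst` (slope `3(m − c₀θ^{k₁})/4 − r ≥ 0`, defect `(slope + β′)·k₂`; binders = rate + one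
certified value + `hk₂` + `RemainderConst` + the printed LOWER half `hlo` — no (C), no upper bound, no DAG),
`betaAvgAFH_of_certifiedConst_list` (+ the certified list ⟹ defect 0), and the bundled form `betaAvgAFH_of_eventualFormOfCertifiedConst`
(literally asym2's sentence).  §2 THE CONSUMERS: `certifiedConst_END_allProfiles` (`EndpointExistence ∧ ∃ γ₁ > 0, ∀ γ ≤ min γ₀ γ₁, ∀ runs in
]0,γ], ∀ p′ ≤ p, ∀ A₀ ≥ 0: sizes ∧ HorizonFacts` — (2.6)–(2.9) + (2.46) of [Balaban1988Convergent] pp. 255–263 —, `r <` strict),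
`certifiedConst_flowIneq_allProfiles` ((2.6)–(2.9) all profiles, NO (2.46), `r ≤`, no (C)), `certifiedConst_t4FlowInputs` (the T⁴ cell's
flow-fact binders C19/C20, `r ≤`, no (C)).  §3 NON-VACUITY on asym2's witness `β ≡ 1` (`betaAvgAFH_constOne`).  §4 (v1.1) THE MARGIN × CONSTANT-REMAINDER ROAD: `betaAvgAFH_of_marginConst` (rate + ONE-SIDED list `m ≤ S.β0 k`, `k ≤ k₁` +
`RemainderConst` ⟹ DEFECT-ZERO carrier `BetaAvgAFH (m − c₀θ^{k₁}(1+θ) − r) 0 γ₀ β`, threshold scale 0, no `hk₂`, no lower half), `marginConst_END_allProfiles`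
(`r < m − c₀θ^{k₁}(1+θ)` = asym2's ONE inequality, `BETA/ASYM2.md` v1.5 §10.1), `marginConst_flowIneq_allProfiles` / `marginConst_t4FlowInputs` (`r ≤`, no (C)).
§5 (v1.2) THE REAL-ZONE × CONSTANT and BLOCK-TRANSFER × CONSTANT ROADS: `betaAvgAFH_of_realMarginConst` (asym1's REAL step rate for the one-loop kernels +
strip bound + exponential moments + radii `0 < ρ < R` + one-sided list + `RemainderConst` ⟹ DEFECT-ZERO carrier at the transported constants
`θ₁ = θ^{1−ρ/R}`, `c₀ = 3c^{1−ρ/R}(2M)^{ρ/R}/(ρ²(1−θ₁))`), `realMarginConst_END_allProfiles` (+ `_decay`: strip bound and moments from the printed (5.10)),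
`realMarginConst_flowIneq_allProfiles` / `realMarginConst_t4FlowInputs`; `betaAvgAFH_of_blockMarginConst` (small-block `CauchyRate b a θ` + the located
composition hypothesis `hblock : S.β0 k = blockSum n b k` (Q-asym1-5, a binder) + small-block block-sum certificates + `RemainderConst` ⟹ DEFECT-ZERO
carrier, `θ₁ = θⁿ`, `c₀ = a(Σ_{i<n}θ^i)²/(1−θⁿ)`), `blockMarginConst_END_allProfiles` / `_flowIneq_allProfiles` / `_t4FlowInputs`; non-vacuity with
positive slope on asym2's scale-dependent block witness (`blockMarginConst_carrier_nonvacuous`).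
§6 (v1.3) THE NEAR-SEQUENCE TRANSFER × CONSTANT ROADS: `betaAvgAFH_of_nearMarginConst` (a `GeomRate a binf c₀ θ` of a COMPARISON sequence `a` + the located
nearness `NearRate a S.β0 e θ` (asym1's one-loop scheme-transfer rate, Q-asym1-5 in inequality form — a binder) + one-sided list on `a` + `RemainderConst` ⟹
DEFECT-ZERO carrier with slope `m − e − (c₀+e)θ^{k₁}(1+θ) − r`), `nearMarginConst_END_allProfiles` / `_flowIneq_allProfiles` / `_t4FlowInputs`;
`betaAvgAFH_of_blockNearMarginConst` (small-block `CauchyRate b a θ` + `NearRate (blockSum n b) S.β0 e (θⁿ)` + small-block block-sum certificates + `RemainderConst`),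
`blockNearMarginConst_END_allProfiles` / `_flowIneq_allProfiles` / `_t4FlowInputs`; `nearMarginConst_carrier_nonvacuous` (positive slope with a GENUINE nearness).
§7 (v1.4) THE CUMULATIVE SCHEME / L-TRANSFER DEFECT × CONSTANT ROADS (RULING (R19) on the [III] side): END grade — `betaAvgAFH_of_cumNearConst` (comparison
`GeomRate a binf c₀ θ`, `θ < 1` + the located CUMULATIVE nearness `CumNear a S.β0 Γ` + `RemainderConst` ⟹ the DRIFT carrier `BetaAvgAFH (binf − r) (2(c₀/(1−θ)+Γ)) γ₀ β`:
`Γ` enters the DEFECT only, NO condition relates it to the margin), `cumNearConst_END_allProfiles` (ONE certified value `m ≤ a k₁`, `r < m − c₀θ^{k₁}` STRICT) /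
`_flowIneq_allProfiles` / `_t4FlowInputs` (`r ≤`), the block road from small-block data `blockCumNearConst_END_allProfiles` and, with the (R19) CONCLUSION SHAPE
ITSELF as the binder (`hLT`, supplied by the lead's `ScalewiseVectorSeam.lTransfer_flowSum_le_of_hU` from two (D1) full-sum binders), `lTransferConst_END_allProfiles`
/ `lTransferConst_t4FlowInputs` — NO numeric condition on `U`; Theorem-2 grade — `betaAvgAFH_of_cumNearMarginConst` (DEFECT-ZERO carrier, slope
`m − c₀θ^{k₁}(1+θ) − 2Γ − r`: here `Γ` IS paid against the margin, (R19-3)'s certificate question), `cumNearMarginConst_END_allProfiles`;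
`cumNearConst_carrier_nonvacuous` (asym2's OSCILLATING-defect witness: drift carrier at slope ≥ 0, defect-zero carrier at slope > 0).  §8 (v1.4) THE EVENTUAL RATE × CONSTANT ROAD: `betaAvgAFH_of_evMarginConst` (`EvGeomRate S.β0
binf c₀ θ k₁` — the rate owed from the threshold `k₁` only — + the certified list for EVERY `k ≤ k₁` + `RemainderConst` ⟹ DEFECT-ZERO carrier, slope
`m − c₀θ^{k₁}(1+θ) − r`, the SAME as §4's), `evMarginConst_END_allProfiles` / `_flowIneq_allProfiles` / `_t4FlowInputs`, `evCauchyMarginConst_END_allProfiles`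
(`c₀ = c/(1−θ)`), `evMarginConst_carrier_nonvacuous` (asym2's witness with NO rate below the threshold).
Source located (consumer locators, quoted verbatim in `B14FlowStep` / `AveragedAFCarrier`, nothing newly quoted): [Balaban1987RG1, Thm 2
p.259, §1 p.264, (2.12)–(2.14) p.268]; [Balaban1988Convergent, (2.5)–(2.9) pp.255–256, (2.28) p.259, (2.46) p.263].
-/

namespace Literature.MathematicalPhysics.QuantumFieldTheory.Balaban1983to89.Beta.AveragedAFCarrierCertified

open Literature.MathematicalPhysics.QuantumFieldTheory.Balaban1983to89
open FlowStep FlowStepRuns DagBinding B14DeltaBeta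
open Literature.MathematicalPhysics.QuantumFieldTheory.Balaban1983to89.Beta.Assembly (EventualForm)
open Literature.MathematicalPhysics.QuantumFieldTheory.Balaban1983to89.Beta.RemainderChain (RemainderConst)
open Literature.MathematicalPhysics.QuantumFieldTheory.Balaban1983to89.Beta.RateCertificate (GeomRate)
open RemainderConstCertified AveragedAFCarrier

noncomputable section

variable {β : HBeta}

/-! ## §1 The carrier from the three lanes -/

/-- **THE THREE LANES ⟹ THE CARRIER** (slope ≥ 0 form).  (asym) `GeomRate S.β0 binf c₀ θ`, `0 ≤ θ ≤ 1`, `binf` any real; (cap) ONE certified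
lower value `m ≤ β⁰_{k₁+1}` and an index `k₂` with `c₀θ^{k₂} ≤ (m − c₀θ^{k₁})/4`; (asym2/an4) `RemainderConst S γ₀ r` with
`r ≤ 3(m − c₀θ^{k₁})/4`; the printed LOWER half `−β′ ≤ β_{k+1}` (`β′ ≥ 0`) ⟹ `BetaAvgAFH (3(m − c₀θ^{k₁})/4 − r) ((3(m − c₀θ^{k₁})/4 − r + β′)·k₂) γ₀ β`
— asym2's tail floor (`tail_floor_of_cert` + `betaLowerTail_of_floor_const`) fed to the Gloss-2 source `betaAvgAFH_of_eventualLower`.  No (C),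
no upper bound, no DAG, no `0 < β⁰_∞`, no (AF-1). [cite: Balaban1987RG1, §1 p.264 and (2.12)–(2.14) p.268] -/
theorem betaAvgAFH_of_certifiedConst (S : B12Beta.OneLoopSplit β) {γ₀ binf c₀ θ r β' m : ℝ} {k₁ k₂ : ℕ}
    (hθ0 : 0 ≤ θ) (hθ1 : θ ≤ 1) (hconv : GeomRate S.β0 binf c₀ θ) (hcert : m ≤ S.β0 k₁)
    (hk₂ : c₀ * θ ^ k₂ ≤ (m - c₀ * θ ^ k₁) / 4) (hrem : RemainderConst S γ₀ r) (hr : r ≤ 3 * (m - c₀ * θ ^ k₁) / 4)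
    (hβ' : 0 ≤ β') (hlo : ∀ k, ∀ v ∈ Box γ₀ k, -β' ≤ β k v) :
    BetaAvgAFH (3 * (m - c₀ * θ ^ k₁) / 4 - r) ((3 * (m - c₀ * θ ^ k₁) / 4 - r + β') * k₂) γ₀ β :=
  betaAvgAFH_of_eventualLower (sub_nonneg.mpr hr) hβ'
    (betaLowerTail_of_floor_const S (tail_floor_of_cert hconv hθ0 hθ1 hcert hk₂) hrem) hlo

/-- **… WITH THE CERTIFIED LIST ⟹ DEFECT ZERO** (the (AF-0s) row of Table 9.1): adding `m₀ ≤ β⁰_{k+1}` for `k < k₂` gives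
`BetaAvgAFH (min m₀ (3(m − c₀θ^{k₁})/4) − r) 0 γ₀ β` (asym2's `betaLowerH_of_certifiedConst` + §2 `betaAvgAFH_of_betaLowerH`); no lower
half `hlo` needed.  On the consumer side the list buys EXACTLY the defect (BETA-SPEC §5.19 (c)). [cite: Balaban1987RG1, (2.12)–(2.14) p.268] -/
theorem betaAvgAFH_of_certifiedConst_list (S : B12Beta.OneLoopSplit β) {γ₀ binf c₀ θ r m m₀ : ℝ} {k₁ k₂ : ℕ}
    (hθ0 : 0 ≤ θ) (hθ1 : θ ≤ 1) (hconv : GeomRate S.β0 binf c₀ θ) (hcert : m ≤ S.β0 k₁)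
    (hk₂ : c₀ * θ ^ k₂ ≤ (m - c₀ * θ ^ k₁) / 4) (hsmall : ∀ k, k < k₂ → m₀ ≤ S.β0 k)
    (hrem : RemainderConst S γ₀ r) : BetaAvgAFH (min m₀ (3 * (m - c₀ * θ ^ k₁) / 4) - r) 0 γ₀ β :=
  betaAvgAFH_of_betaLowerH (betaLowerH_of_certifiedConst S hθ0 hθ1 hconv hcert hk₂ hsmall hrem)

/-- **asym2's SENTENCE, LITERALLY**: `betaAvgAFH_of_eventualForm (eventualFormOfCertifiedConst …)` — the bundled Gloss-2 carrier of the three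
lanes (with (C) and the upper bound among its fields) gives `BetaAvgAFH E.b ((E.b + E.β′)·E.k₀) E.γ₀ β`, `E.b = 3(m − c₀θ^{k₁})/4 − r`,
`E.k₀ = k₂` (`eventualFormOfCertifiedConst_consts`). [folklore] -/
theorem betaAvgAFH_of_eventualFormOfCertifiedConst (S : B12Beta.OneLoopSplit β) {γ₀ binf c₀ θ r β' m : ℝ} {k₁ k₂ : ℕ}
    (hγ₀ : 0 < γ₀) (hθ0 : 0 ≤ θ) (hθ1 : θ ≤ 1) (hconv : GeomRate S.β0 binf c₀ θ) (hcert : m ≤ S.β0 k₁)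
    (hk₂ : c₀ * θ ^ k₂ ≤ (m - c₀ * θ ^ k₁) / 4) (hrem : RemainderConst S γ₀ r)
    (hr : r < 3 * (m - c₀ * θ ^ k₁) / 4) (hup : BetaUpperH β' γ₀ β) (hlo : ∀ k, ∀ v ∈ Box γ₀ k, -β' ≤ β k v)
    (hcont : BetaContH γ₀ β) :
    BetaAvgAFH (3 * (m - c₀ * θ ^ k₁) / 4 - r) ((3 * (m - c₀ * θ ^ k₁) / 4 - r + β') * k₂) γ₀ β :=
  betaAvgAFH_of_eventualForm (eventualFormOfCertifiedConst S hγ₀ hθ0 hθ1 hconv hcert hk₂ hrem hr hup hlo hcont)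

/-! ## §2 The consumers: the located [III] list, (2.6)–(2.9) without (2.46), the T⁴ flow-fact binders -/

/-- **THE THREE LANES ⟹ THE END STATEMENT, [III] SIDE, ALL PROFILES.**  The binders of asym2's
`RemainderConstCertified.endpointExistence_of_certifiedConst` (rate, one certified value, `hk₂`, `RemainderConst` with `r < 3(m − c₀θ^{k₁})/4`
STRICTLY, the printed two-sided bound, (C)) + the [III] run-side data (`HaltsOutside`, `CurriesHBeta`, `0 < β₀`, `L ≥ 2`, maximal `p`, `κ₀ ≥ 6`)
⟹ `EndpointExistence C ∧ ∃ γ₁ > 0`, along every run in `]0,γ]`, `γ ≤ min γ₀ γ₁`, for every `p′ ≤ p` and `A₀ ≥ 0`: sizes ∧ `HorizonFacts`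
((2.6)–(2.9) + (2.46)), every `β₀ > 0` — §1's carrier through `BetaAvgAFH.endpoint_and_flowControl_allProfiles`.  No small-k list, no sign of
`β⁰_∞`, no (AF-1). [cite: Balaban1987RG1, Thm 2 p.259 and Thm 3 p.264] [cite: Balaban1988Convergent, (2.5)–(2.9) pp.255–256, (2.28) p.259, (2.46) p.263] -/
theorem certifiedConst_END_allProfiles {C : B12.Construction} (hgen : ForwardGenerated C β) (hhalt : HaltsOutside C β)
    (hcur : CurriesHBeta C β) (S : B12Beta.OneLoopSplit β) {γ₀ binf c₀ θ r β' m : ℝ} {k₁ k₂ : ℕ} (hγ₀ : 0 < γ₀)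
    (hθ0 : 0 ≤ θ) (hθ1 : θ ≤ 1) (hconv : GeomRate S.β0 binf c₀ θ) (hcert : m ≤ S.β0 k₁)
    (hk₂ : c₀ * θ ^ k₂ ≤ (m - c₀ * θ ^ k₁) / 4) (hrem : RemainderConst S γ₀ r) (hr : r < 3 * (m - c₀ * θ ^ k₁) / 4)
    (hup : BetaUpperH β' γ₀ β) (hlo : ∀ k, ∀ v ∈ Box γ₀ k, -β' ≤ β k v) (hcont : BetaContH γ₀ β) (hβ' : 0 ≤ β')
    {β₀ : ℝ} (hβ₀ : 0 < β₀) {L : ℕ} (hL2 : 2 ≤ L) (p : ℕ) {κ₀ : ℕ} (hκ : 6 ≤ κ₀) :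
    EndpointExistence C ∧ ∃ γ₁ : ℝ, 0 < γ₁ ∧
      ∀ γ : ℝ, 0 < γ → γ ≤ min γ₀ γ₁ → ∀ Pr : B12.RunParams, (C Pr).flow.InInterval γ Pr.K →
        ∀ p' : ℕ, p' ≤ p → ∀ A₀ : ℝ, 0 ≤ A₀ →
          ∃ Rj : ℕ → ℕ, (∀ j, B14.IsRj L p' ((C Pr).flow.g j) (Rj j)) ∧
            HorizonFacts (C Pr).flow β' β₀ A₀ L p' κ₀ Rj Pr.K :=
  (betaAvgAFH_of_certifiedConst S hθ0 hθ1 hconv hcert hk₂ hrem hr.le hβ' hlo).endpoint_and_flowControl_allProfiles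
    (sub_pos.mpr hr) hgen hhalt hcur hγ₀ hβ' hβ₀ hL2 p hcont hup hκ

/-- **THE THREE LANES AT SLOPE ≥ 0 ⟹ (2.6)–(2.9) FOR ALL PROFILES, WITHOUT (2.46)** (`r ≤ 3(m − c₀θ^{k₁})/4`; NO continuity; the printed
two-sided bound; run-side data) — §1's carrier through `BetaAvgAFH.flowIneq_allProfiles` (census rows C1–C7, C11, C12, C15, C19, C20 are
«slope ≥ 0» rows). [cite: Balaban1988Convergent, (2.5)–(2.9) pp.255–256] -/
theorem certifiedConst_flowIneq_allProfiles {C : B12.Construction} (hgen : ForwardGenerated C β) (hhalt : HaltsOutside C β)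
    (hcur : CurriesHBeta C β) (S : B12Beta.OneLoopSplit β) {γ₀ binf c₀ θ r β' m : ℝ} {k₁ k₂ : ℕ} (hγ₀ : 0 < γ₀)
    (hθ0 : 0 ≤ θ) (hθ1 : θ ≤ 1) (hconv : GeomRate S.β0 binf c₀ θ) (hcert : m ≤ S.β0 k₁)
    (hk₂ : c₀ * θ ^ k₂ ≤ (m - c₀ * θ ^ k₁) / 4) (hrem : RemainderConst S γ₀ r) (hr : r ≤ 3 * (m - c₀ * θ ^ k₁) / 4)
    (hup : BetaUpperH β' γ₀ β) (hlo : ∀ k, ∀ v ∈ Box γ₀ k, -β' ≤ β k v) (hβ' : 0 ≤ β')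
    {β₀ : ℝ} (hβ₀ : 0 < β₀) {L : ℕ} (hL2 : 2 ≤ L) (p : ℕ) :
    ∃ γ₁ : ℝ, 0 < γ₁ ∧
      ∀ γ : ℝ, 0 < γ → γ ≤ min γ₀ γ₁ → ∀ Pr : B12.RunParams, (C Pr).flow.InInterval γ Pr.K →
        ∀ p' : ℕ, p' ≤ p → ∀ A₀ : ℝ, 0 ≤ A₀ →
          ∃ Rj : ℕ → ℕ, (∀ j, B14.IsRj L p' ((C Pr).flow.g j) (Rj j)) ∧
            B14.FlowIneq26 (C Pr).flow.g β' β₀ Pr.K ∧ B14.FlowIneq27 (C Pr).flow.g β' β₀ p' Pr.K ∧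
            B14.FlowIneq28 (epsK A₀ p' (C Pr).flow) (C Pr).flow.g β' β₀ Pr.K ∧
            B14FlowStep.FlowIneq29 Rj (C Pr).flow.g L β' β₀ Pr.K :=
  (betaAvgAFH_of_certifiedConst S hθ0 hθ1 hconv hcert hk₂ hrem hr hβ' hlo).flowIneq_allProfiles (sub_nonneg.mpr hr) hgen hhalt
    hcur hγ₀ hβ' hβ₀ hL2 p hup

/-- **THE THREE LANES AT SLOPE ≥ 0 ⟹ THE T⁴ CELL's FLOW-FACT BINDERS** (census C19/C20: `T4ScalePairing.kappa_mul_R_le_p0Profile`'s (2.7) at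
`p₀` + radii at `r′ ≤ p₀` + the log-clause, `T4UniformRadius`' (2.9)), below ONE threshold — §1's carrier through
`BetaAvgAFH.t4FlowInputs_of_nonneg`; `r ≤ 3(m − c₀θ^{k₁})/4`, NO continuity. [cite: Balaban1988Convergent, (2.5)–(2.9) pp.255–256] -/
theorem certifiedConst_t4FlowInputs {C : B12.Construction} (hgen : ForwardGenerated C β) (hhalt : HaltsOutside C β)
    (hcur : CurriesHBeta C β) (S : B12Beta.OneLoopSplit β) {γ₀ binf c₀ θ r β' m : ℝ} {k₁ k₂ : ℕ} (hγ₀ : 0 < γ₀)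
    (hθ0 : 0 ≤ θ) (hθ1 : θ ≤ 1) (hconv : GeomRate S.β0 binf c₀ θ) (hcert : m ≤ S.β0 k₁)
    (hk₂ : c₀ * θ ^ k₂ ≤ (m - c₀ * θ ^ k₁) / 4) (hrem : RemainderConst S γ₀ r) (hr : r ≤ 3 * (m - c₀ * θ ^ k₁) / 4)
    (hup : BetaUpperH β' γ₀ β) (hlo : ∀ k, ∀ v ∈ Box γ₀ k, -β' ≤ β k v) (hβ' : 0 ≤ β')
    {β₀ : ℝ} (hβ₀ : 0 < β₀) {L : ℕ} (hL2 : 2 ≤ L) {p₀ r' : ℕ} (hr' : r' ≤ p₀) :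
    ∃ γ₁ : ℝ, 0 < γ₁ ∧ ∀ γ : ℝ, 0 < γ → γ ≤ min γ₀ γ₁ → ∀ Pr : B12.RunParams, (C Pr).flow.InInterval γ Pr.K →
      B14.FlowIneq27 (C Pr).flow.g β' β₀ p₀ Pr.K ∧
      (∀ j, j ≤ Pr.K → 1 ≤ Real.log (((C Pr).flow.g j) ^ 2)⁻¹) ∧
      ∃ Rj : ℕ → ℕ, (∀ j, B14.IsRj L r' ((C Pr).flow.g j) (Rj j)) ∧ B14FlowStep.FlowIneq29 Rj (C Pr).flow.g L β' β₀ Pr.K :=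
  (betaAvgAFH_of_certifiedConst S hθ0 hθ1 hconv hcert hk₂ hrem hr hβ' hlo).t4FlowInputs_of_nonneg (sub_nonneg.mpr hr) hgen hhalt
    hcur hγ₀ hβ' hβ₀ hL2 hr' hup

/-! ## §3 Non-vacuity: the §1 binders are jointly satisfiable (asym2's witness `β ≡ 1`) -/

section Witness

open Assembly.Witness (constOne splitOne)
open RemainderConstCertified.Witness (geomRate_splitOne remainderConst_splitOne)

/-- On the constant family `β ≡ 1` (`β⁰ ≡ 1`, `β¹ ≡ 0`; rate `GeomRate _ 1 0 0`, certificate `m = 1` at `k₁ = 0`, `k₂ = 0`, `r = 0`, `β′ = 1`,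
`γ₀ = 1`) §1 returns the carrier with slope `3(1 − 0·0⁰)/4 − 0` (`= 3/4`) and defect `(… + 1)·0` (`= 0`). [folklore] -/
theorem betaAvgAFH_constOne :
    BetaAvgAFH (3 * (1 - 0 * (0 : ℝ) ^ 0) / 4 - 0) ((3 * (1 - 0 * (0 : ℝ) ^ 0) / 4 - 0 + 1) * (0 : ℕ)) 1 constOne :=
  betaAvgAFH_of_certifiedConst splitOne (binf := 1) (k₂ := 0) le_rfl zero_le_one geomRate_splitOne (by simp [splitOne])
    (by norm_num) remainderConst_splitOne (by norm_num) zero_le_one (fun _ _ _ => by show (-1 : ℝ) ≤ 1; norm_num)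

/-- … numerically: slope `3/4`, defect `0`, on `]0,1]`. [folklore] -/
theorem betaAvgAFH_constOne' : BetaAvgAFH (3 / 4) 0 1 constOne := by
  have h := betaAvgAFH_constOne
  norm_num at h
  exact h

end Witness

/-! ## §4 (v1.1) The MARGIN × CONSTANT-REMAINDER road on the [III] side (asym1 `RateCertificate` §7 margin form; asym2 `RemainderConstCertified` v1.1 §7)

asym1's margin form (`RateCertificate.GeomRate.tail_ge_margin`, `beta0_lower_all_of_margin`, v1.3 p184366): the rate `GeomRate S.β0 binf c₀ θ`
(`0 ≤ θ ≤ 1`, `binf` any real) and a ONE-SIDED certified list `m ≤ β⁰_{k+1}` for ALL `k ≤ k₁` give the UNIFORM floor `m − c₀θ^{k₁}(1+θ) ≤ β⁰_{k+1}`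
for every `k` — threshold scale `k₀ = 0`, no enclosure, no `hk₂`.  With the constant-form remainder this is a DEFECT-ZERO carrier (the (AF-0s) row of
Table 9.1), and the consumers follow as in §2.  asym2's `thm2Printed_of_marginConst` (v1.1 §7) is the Theorem-2-as-printed form of the same inputs;
here is the [III] side.  Binder census as in the header: rate = the wall's (D1)+(D3) in rate clothing; list = computational leaves; `hrem` = (D4). -/

/-- **MARGIN × CONSTANT REMAINDER ⟹ THE CARRIER, DEFECT ZERO**: (asym) `GeomRate S.β0 binf c₀ θ`, `0 ≤ θ ≤ 1`; (cap) the one-sided list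
`m ≤ S.β0 k` for all `k ≤ k₁`; (asym2/an4) `RemainderConst S γ₀ r` ⟹ `BetaAvgAFH (m − c₀θ^{k₁}(1+θ) − r) 0 γ₀ β` — asym1's uniform floor
`beta0_lower_all_of_margin` + asym2's `betaLowerH_of_floor_const` + §2 `betaAvgAFH_of_betaLowerH`.  No `hk₂`, no lower half `hlo`, no (C), no upper
bound; the slope is positive iff `r < m − c₀θ^{k₁}(1+θ)` (asym2's ONE inequality, ASYM2 §10.1). [cite: Balaban1987RG1, (2.12)–(2.14) p.268] -/
theorem betaAvgAFH_of_marginConst (S : B12Beta.OneLoopSplit β) {γ₀ binf c₀ θ r m : ℝ} {k₁ : ℕ}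
    (hθ0 : 0 ≤ θ) (hθ1 : θ ≤ 1) (hconv : GeomRate S.β0 binf c₀ θ) (hlist : ∀ k, k ≤ k₁ → m ≤ S.β0 k)
    (hrem : RemainderConst S γ₀ r) : BetaAvgAFH (m - c₀ * θ ^ k₁ * (1 + θ) - r) 0 γ₀ β :=
  betaAvgAFH_of_betaLowerH (betaLowerH_of_floor_const S (RateCertificate.beta0_lower_all_of_margin S hθ0 hθ1 hconv hlist) hrem)

/-- **MARGIN × CONSTANT REMAINDER ⟹ THE END STATEMENT, [III] SIDE, ALL PROFILES**: the binders of asym2's `thm2Printed_of_marginConst` minus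
`L`/`hL` (rate, one-sided list, `RemainderConst` with `r < m − c₀θ^{k₁}(1+θ)` STRICTLY, (C), (U) with `β′ ≥ 0`) + the [III] run-side data ⟹
`EndpointExistence C ∧ ∃ γ₁ > 0, ∀ γ ≤ min γ₀ γ₁, ∀ runs in ]0,γ], ∀ p′ ≤ p, ∀ A₀ ≥ 0: sizes ∧ HorizonFacts` ((2.6)–(2.9) + (2.46)), every `β₀ > 0`.
[cite: Balaban1987RG1, Thm 2 p.259 and Thm 3 p.264] [cite: Balaban1988Convergent, (2.5)–(2.9) pp.255–256, (2.28) p.259, (2.46) p.263] -/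
theorem marginConst_END_allProfiles {C : B12.Construction} (hgen : ForwardGenerated C β) (hhalt : HaltsOutside C β)
    (hcur : CurriesHBeta C β) (S : B12Beta.OneLoopSplit β) {γ₀ binf c₀ θ r β' m : ℝ} {k₁ : ℕ} (hγ₀ : 0 < γ₀)
    (hθ0 : 0 ≤ θ) (hθ1 : θ ≤ 1) (hconv : GeomRate S.β0 binf c₀ θ) (hlist : ∀ k, k ≤ k₁ → m ≤ S.β0 k)
    (hrem : RemainderConst S γ₀ r) (hr : r < m - c₀ * θ ^ k₁ * (1 + θ))
    (hcont : BetaContH γ₀ β) (hup : BetaUpperH β' γ₀ β) (hβ' : 0 ≤ β')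
    {β₀ : ℝ} (hβ₀ : 0 < β₀) {L : ℕ} (hL2 : 2 ≤ L) (p : ℕ) {κ₀ : ℕ} (hκ : 6 ≤ κ₀) :
    EndpointExistence C ∧ ∃ γ₁ : ℝ, 0 < γ₁ ∧
      ∀ γ : ℝ, 0 < γ → γ ≤ min γ₀ γ₁ → ∀ Pr : B12.RunParams, (C Pr).flow.InInterval γ Pr.K →
        ∀ p' : ℕ, p' ≤ p → ∀ A₀ : ℝ, 0 ≤ A₀ →
          ∃ Rj : ℕ → ℕ, (∀ j, B14.IsRj L p' ((C Pr).flow.g j) (Rj j)) ∧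
            HorizonFacts (C Pr).flow β' β₀ A₀ L p' κ₀ Rj Pr.K :=
  (betaAvgAFH_of_marginConst S hθ0 hθ1 hconv hlist hrem).endpoint_and_flowControl_allProfiles (sub_pos.mpr hr) hgen hhalt hcur hγ₀
    hβ' hβ₀ hL2 p hcont hup hκ

/-- **MARGIN × CONSTANT REMAINDER AT SLOPE ≥ 0 ⟹ (2.6)–(2.9) FOR ALL PROFILES, WITHOUT (2.46)** (`r ≤ m − c₀θ^{k₁}(1+θ)`; NO continuity).
[cite: Balaban1988Convergent, (2.5)–(2.9) pp.255–256] -/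
theorem marginConst_flowIneq_allProfiles {C : B12.Construction} (hgen : ForwardGenerated C β) (hhalt : HaltsOutside C β)
    (hcur : CurriesHBeta C β) (S : B12Beta.OneLoopSplit β) {γ₀ binf c₀ θ r β' m : ℝ} {k₁ : ℕ} (hγ₀ : 0 < γ₀)
    (hθ0 : 0 ≤ θ) (hθ1 : θ ≤ 1) (hconv : GeomRate S.β0 binf c₀ θ) (hlist : ∀ k, k ≤ k₁ → m ≤ S.β0 k)
    (hrem : RemainderConst S γ₀ r) (hr : r ≤ m - c₀ * θ ^ k₁ * (1 + θ)) (hup : BetaUpperH β' γ₀ β) (hβ' : 0 ≤ β')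
    {β₀ : ℝ} (hβ₀ : 0 < β₀) {L : ℕ} (hL2 : 2 ≤ L) (p : ℕ) :
    ∃ γ₁ : ℝ, 0 < γ₁ ∧
      ∀ γ : ℝ, 0 < γ → γ ≤ min γ₀ γ₁ → ∀ Pr : B12.RunParams, (C Pr).flow.InInterval γ Pr.K →
        ∀ p' : ℕ, p' ≤ p → ∀ A₀ : ℝ, 0 ≤ A₀ →
          ∃ Rj : ℕ → ℕ, (∀ j, B14.IsRj L p' ((C Pr).flow.g j) (Rj j)) ∧
            B14.FlowIneq26 (C Pr).flow.g β' β₀ Pr.K ∧ B14.FlowIneq27 (C Pr).flow.g β' β₀ p' Pr.K ∧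
            B14.FlowIneq28 (epsK A₀ p' (C Pr).flow) (C Pr).flow.g β' β₀ Pr.K ∧
            B14FlowStep.FlowIneq29 Rj (C Pr).flow.g L β' β₀ Pr.K :=
  (betaAvgAFH_of_marginConst S hθ0 hθ1 hconv hlist hrem).flowIneq_allProfiles (sub_nonneg.mpr hr) hgen hhalt hcur hγ₀ hβ' hβ₀ hL2 p hup

/-- **MARGIN × CONSTANT REMAINDER AT SLOPE ≥ 0 ⟹ THE T⁴ CELL's FLOW-FACT BINDERS** (C19/C20; NO continuity). [cite: Balaban1988Convergent, (2.5)–(2.9) pp.255–256] -/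
theorem marginConst_t4FlowInputs {C : B12.Construction} (hgen : ForwardGenerated C β) (hhalt : HaltsOutside C β)
    (hcur : CurriesHBeta C β) (S : B12Beta.OneLoopSplit β) {γ₀ binf c₀ θ r β' m : ℝ} {k₁ : ℕ} (hγ₀ : 0 < γ₀)
    (hθ0 : 0 ≤ θ) (hθ1 : θ ≤ 1) (hconv : GeomRate S.β0 binf c₀ θ) (hlist : ∀ k, k ≤ k₁ → m ≤ S.β0 k)
    (hrem : RemainderConst S γ₀ r) (hr : r ≤ m - c₀ * θ ^ k₁ * (1 + θ)) (hup : BetaUpperH β' γ₀ β) (hβ' : 0 ≤ β')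
    {β₀ : ℝ} (hβ₀ : 0 < β₀) {L : ℕ} (hL2 : 2 ≤ L) {p₀ r' : ℕ} (hr' : r' ≤ p₀) :
    ∃ γ₁ : ℝ, 0 < γ₁ ∧ ∀ γ : ℝ, 0 < γ → γ ≤ min γ₀ γ₁ → ∀ Pr : B12.RunParams, (C Pr).flow.InInterval γ Pr.K →
      B14.FlowIneq27 (C Pr).flow.g β' β₀ p₀ Pr.K ∧
      (∀ j, j ≤ Pr.K → 1 ≤ Real.log (((C Pr).flow.g j) ^ 2)⁻¹) ∧
      ∃ Rj : ℕ → ℕ, (∀ j, B14.IsRj L r' ((C Pr).flow.g j) (Rj j)) ∧ B14FlowStep.FlowIneq29 Rj (C Pr).flow.g L β' β₀ Pr.K :=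
  (betaAvgAFH_of_marginConst S hθ0 hθ1 hconv hlist hrem).t4FlowInputs_of_nonneg (sub_nonneg.mpr hr) hgen hhalt hcur hγ₀ hβ' hβ₀ hL2 hr'
    hup

/-! ## §5 (v1.2) The REAL-ZONE × CONSTANT and BLOCK-TRANSFER × CONSTANT roads on the [III] side (asym1 `RateCertificate` §9/§10;
asym2 `RemainderConstCertified` v1.2 §8, p185035)

asym2's §8 puts the constant-form remainder `RemainderConst S γ₀ r` into asym1's REAL-ZONE socket — a real step rate
`RealStepRate P μ ν c θ` (`0 < c`, `0 < θ < 1`) for one-loop kernels `P k` with `S.β0 k = secondMoment (P k) μ ν` ((1.22) at zero couplings),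
a uniform strip bound `StripBound P μ ν R M` with `c ≤ 2M` and the exponential moments of radius `R` (both dischargeable from the printed
uniform decay (5.10): `stripBound_of_decay510`, `expMoments_of_decay510`), radii `0 < ρ < R` — and into the BLOCK-TRANSFER road — a
small-block `CauchyRate b a θ` (`0 ≤ θ < 1`, `0 < n`), the COMPOSITION HYPOTHESIS `hblock : S.β0 k = blockSum n b k` (asym1's located
Q-asym1-5: NOT printed, NOT asserted — a binder) and small-block block-sum certificates `m ≤ blockSum n b k`, `k ≤ k₁` —, landing in
`BetaLowerH (m − c₀θ₁^{k₁}(1+θ₁) − r) γ₀ β` at the transported rate constants (real zone: `θ₁ = θ^{1−ρ/R}`,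
`c₀ = 3c^{1−ρ/R}(2M)^{ρ/R}/(ρ²(1−θ₁))`; block: `θ₁ = θⁿ`, `c₀ = a(Σ_{i<n}θ^i)²/(1−θⁿ)`; asym1's radii `(R, r)` are written `(R, ρ)` because
`r` is the remainder constant).  Here is the [III] side, exactly as in §4: the DEFECT-ZERO carrier by `betaAvgAFH_of_betaLowerH` and the
three consumers of `AveragedAFCarrier` §11/§12, binders = asym2's VERBATIM minus `L`/`hL` (resp. `L'`/`hL`) plus the [III] run-side data
(`HaltsOutside`, `CurriesHBeta`, `0 < β₀`, `L ≥ 2`, maximal exponent `p`, `κ₀ ≥ 6`).  Binder census as in the header: the real step rate /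
the small-block Cauchy rate = the wall's (D1)+(D3) in rate clothing (cell item O-asym1-1, NOT a lane output); the lists = COMPUTATIONAL
LEAVES (cap); `hrem` = (D4); `hcont` = (D5); `hup`/(5.10) = printed-TYPE binders; `hblock` = Q-asym1-5 (located, unprinted); `hgen`/`hhalt`/
`hcur` STRUCTURAL / run-side.  On the block road the [III] run-side block size `L : ℕ` (`2 ≤ L`, the radii base of (2.5)/(2.9)) is a
SEPARATE binder from asym1's small/large one-loop block sizes (which enter only through `b`, `n`, `hblock`).  [folklore] composition of
landed theorems by name; nothing of the series is discharged; NOT Theorem 2, NOT the wall. -/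

section RealBlock

open Literature.MathematicalPhysics.QuantumFieldTheory.Balaban1983to89.Beta.RateCertificate
  (RealStepRate StripBound CauchyRate blockSum ratio_lt_one stripBound_of_decay510 expMoments_of_decay510)

variable {d : ℕ}

/-- **REAL-ZONE × CONSTANT REMAINDER ⟹ THE CARRIER, DEFECT ZERO**: asym2's `betaLowerH_of_realMarginConst` (real step rate ∘ three
lines ∘ Cauchy ∘ margin ∘ constant remainder: `β_{k+1} ≥ m − c₀θ₁^{k₁}(1+θ₁) − r` on ALL boxes, `θ₁ = θ^{1−ρ/R}`,
`c₀ = 3c^{1−ρ/R}(2M)^{ρ/R}/(ρ²(1−θ₁))`) through `betaAvgAFH_of_betaLowerH`: `BetaAvgAFH (m − c₀θ₁^{k₁}(1+θ₁) − r) 0 γ₀ β`.  No (C), no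
upper bound, no DAG, no `0 < β⁰_∞`, no (AF-1), no threshold scale. [cite: Balaban1987RG1, (1.22) p.264 and (2.12)–(2.14) p.268] -/
theorem betaAvgAFH_of_realMarginConst (S : B12Beta.OneLoopSplit β) {P : ℕ → B12Beta.Kernel d} {μ ν : Fin d}
    (hP : ∀ k, PolarizationSign.MomentSummable (P k) 2) (hβ0 : ∀ k, S.β0 k = B12Beta.secondMoment (P k) μ ν)
    {γ₀ R ρ c θ M r m : ℝ} {k₁ : ℕ} (hR : 0 < R) (hρ : 0 < ρ) (hρR : ρ < R) (hc : 0 < c) (hθ0 : 0 < θ)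
    (hθ1 : θ < 1) (hrate : RealStepRate P μ ν c θ) (hB : StripBound P μ ν R M) (hcM : c ≤ 2 * M)
    (hE : ∀ k, ∀ v ∈ ({Pi.single μ 1, Pi.single ν 1, Pi.single μ 1 + Pi.single ν 1} : Set (Fin d → ℤ)),
      MomentSymbol.ExpMoment (P k μ ν) v R)
    (hlist : ∀ k, k ≤ k₁ → m ≤ S.β0 k) (hrem : RemainderConst S γ₀ r) :
    BetaAvgAFH (m - 3 * (c ^ (1 - ρ / R) * (2 * M) ^ (ρ / R)) / ρ ^ 2 / (1 - θ ^ (1 - ρ / R))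
      * (θ ^ (1 - ρ / R)) ^ k₁ * (1 + θ ^ (1 - ρ / R)) - r) 0 γ₀ β :=
  betaAvgAFH_of_betaLowerH
    (betaLowerH_of_realMarginConst S hP hβ0 hR hρ hρR hc hθ0 hθ1 hrate hB hcM hE hlist hrem)

/-- **REAL-ZONE × CONSTANT REMAINDER ⟹ THE END STATEMENT, [III] SIDE, ALL PROFILES**: the binders of asym2's
`thm2Printed_of_realMarginConst` minus `L`/`hL` (split, one-loop kernels with `S.β0 k = secondMoment (P k) μ ν`, real step rate, strip
bound with `c ≤ 2M`, exponential moments, radii `0 < ρ < R`, one-sided list, `RemainderConst` with `r < m − c₀θ₁^{k₁}(1+θ₁)` STRICTLY,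
(C), (U) with `β′ ≥ 0`) + the [III] run-side data ⟹ `EndpointExistence C ∧ ∃ γ₁ > 0, ∀ γ ≤ min γ₀ γ₁, ∀ runs in ]0,γ], ∀ p′ ≤ p,
∀ A₀ ≥ 0: sizes ∧ HorizonFacts` ((2.6)–(2.9) + (2.46)), every `β₀ > 0`.  Box `]0,γ₀]` NOT shrunk; NO threshold scale.
[cite: Balaban1987RG1, (1.22) p.264, (5.10) p.293, Thm 2 p.259 and Thm 3 p.264]
[cite: Balaban1988Convergent, (2.5)–(2.9) pp.255–256, (2.28) p.259, (2.46) p.263] -/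
theorem realMarginConst_END_allProfiles {C : B12.Construction} (hgen : ForwardGenerated C β)
    (hhalt : HaltsOutside C β) (hcur : CurriesHBeta C β) (S : B12Beta.OneLoopSplit β) {P : ℕ → B12Beta.Kernel d}
    {μ ν : Fin d} (hP : ∀ k, PolarizationSign.MomentSummable (P k) 2)
    (hβ0 : ∀ k, S.β0 k = B12Beta.secondMoment (P k) μ ν) {γ₀ R ρ c θ M r β' m : ℝ} {k₁ : ℕ} (hγ₀ : 0 < γ₀)
    (hR : 0 < R) (hρ : 0 < ρ) (hρR : ρ < R) (hc : 0 < c) (hθ0 : 0 < θ) (hθ1 : θ < 1)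
    (hrate : RealStepRate P μ ν c θ) (hB : StripBound P μ ν R M) (hcM : c ≤ 2 * M)
    (hE : ∀ k, ∀ v ∈ ({Pi.single μ 1, Pi.single ν 1, Pi.single μ 1 + Pi.single ν 1} : Set (Fin d → ℤ)),
      MomentSymbol.ExpMoment (P k μ ν) v R)
    (hlist : ∀ k, k ≤ k₁ → m ≤ S.β0 k) (hrem : RemainderConst S γ₀ r)
    (hr : r < m - 3 * (c ^ (1 - ρ / R) * (2 * M) ^ (ρ / R)) / ρ ^ 2 / (1 - θ ^ (1 - ρ / R))
      * (θ ^ (1 - ρ / R)) ^ k₁ * (1 + θ ^ (1 - ρ / R)))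
    (hcont : BetaContH γ₀ β) (hup : BetaUpperH β' γ₀ β) (hβ' : 0 ≤ β')
    {β₀ : ℝ} (hβ₀ : 0 < β₀) {L : ℕ} (hL2 : 2 ≤ L) (p : ℕ) {κ₀ : ℕ} (hκ : 6 ≤ κ₀) :
    EndpointExistence C ∧ ∃ γ₁ : ℝ, 0 < γ₁ ∧
      ∀ γ : ℝ, 0 < γ → γ ≤ min γ₀ γ₁ → ∀ Pr : B12.RunParams, (C Pr).flow.InInterval γ Pr.K →
        ∀ p' : ℕ, p' ≤ p → ∀ A₀ : ℝ, 0 ≤ A₀ →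
          ∃ Rj : ℕ → ℕ, (∀ j, B14.IsRj L p' ((C Pr).flow.g j) (Rj j)) ∧
            HorizonFacts (C Pr).flow β' β₀ A₀ L p' κ₀ Rj Pr.K :=
  (betaAvgAFH_of_realMarginConst S hP hβ0 hR hρ hρR hc hθ0 hθ1 hrate hB hcM hE hlist hrem)
    |>.endpoint_and_flowControl_allProfiles (sub_pos.mpr hr) hgen hhalt hcur hγ₀ hβ' hβ₀ hL2 p hcont hup hκ

/-- **… ALL-IN-ONE FROM THE PRINTED DECAY (5.10)** (twin of asym2's `thm2Printed_of_realMarginConst_decay` on the [III] side): with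
(5.10) constants `(A, δ₁)` uniform in `k` for the one-loop kernels, `μ ≠ ν` and `R < δ₁`, the strip bound (`M = A·Σ_x e^{−(δ₁−R)|x|₁}`) and
the exponential moments are discharged.  What remains OPEN, precisely: the real step rate (asym1, O-asym1-1), the certified list (cap), the
constant remainder (the chain leaves, (D4)) and (C) ((D5)); printed-SHAPE binders: (5.10) for the one-loop kernels, (U); modelling /
run-side: the DAG, `HaltsOutside`, `CurriesHBeta`. [cite: Balaban1987RG1, (5.10) p.293 and Thm 3 p.264]
[cite: Balaban1988Convergent, (2.5)–(2.9) pp.255–256, (2.46) p.263] -/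
theorem realMarginConst_END_allProfiles_decay {C : B12.Construction} (hgen : ForwardGenerated C β)
    (hhalt : HaltsOutside C β) (hcur : CurriesHBeta C β) (S : B12Beta.OneLoopSplit β) {P : ℕ → B12Beta.Kernel d}
    {μ ν : Fin d} (hne : μ ≠ ν) (hP : ∀ k, PolarizationSign.MomentSummable (P k) 2)
    (hβ0 : ∀ k, S.β0 k = B12Beta.secondMoment (P k) μ ν) {γ₀ A δ₁ R ρ c θ r β' m : ℝ} {k₁ : ℕ} (hγ₀ : 0 < γ₀)
    (hdec : ∀ k, B12Sec2to5.Decay510 (P k μ ν) A δ₁) (hR : 0 < R) (hRδ : R < δ₁) (hρ : 0 < ρ) (hρR : ρ < R)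
    (hc : 0 < c) (hθ0 : 0 < θ) (hθ1 : θ < 1) (hrate : RealStepRate P μ ν c θ)
    (hcM : c ≤ 2 * (A * ∑' x : Fin d → ℤ, Real.exp (-(δ₁ - R) * B12Sec2to5.l1 x)))
    (hlist : ∀ k, k ≤ k₁ → m ≤ S.β0 k) (hrem : RemainderConst S γ₀ r)
    (hr : r < m - 3 * (c ^ (1 - ρ / R) * (2 * (A * ∑' x : Fin d → ℤ, Real.exp (-(δ₁ - R) * B12Sec2to5.l1 x)))
      ^ (ρ / R)) / ρ ^ 2 / (1 - θ ^ (1 - ρ / R)) * (θ ^ (1 - ρ / R)) ^ k₁ * (1 + θ ^ (1 - ρ / R)))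
    (hcont : BetaContH γ₀ β) (hup : BetaUpperH β' γ₀ β) (hβ' : 0 ≤ β')
    {β₀ : ℝ} (hβ₀ : 0 < β₀) {L : ℕ} (hL2 : 2 ≤ L) (p : ℕ) {κ₀ : ℕ} (hκ : 6 ≤ κ₀) :
    EndpointExistence C ∧ ∃ γ₁ : ℝ, 0 < γ₁ ∧
      ∀ γ : ℝ, 0 < γ → γ ≤ min γ₀ γ₁ → ∀ Pr : B12.RunParams, (C Pr).flow.InInterval γ Pr.K →
        ∀ p' : ℕ, p' ≤ p → ∀ A₀ : ℝ, 0 ≤ A₀ →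
          ∃ Rj : ℕ → ℕ, (∀ j, B14.IsRj L p' ((C Pr).flow.g j) (Rj j)) ∧
            HorizonFacts (C Pr).flow β' β₀ A₀ L p' κ₀ Rj Pr.K :=
  realMarginConst_END_allProfiles hgen hhalt hcur S hP hβ0 hγ₀ hR hρ hρR hc hθ0 hθ1 hrate
    (stripBound_of_decay510 hne hdec hR.le hRδ) hcM (expMoments_of_decay510 hne hdec hR.le hRδ) hlist hrem hr hcont
    hup hβ' hβ₀ hL2 p hκ

/-- **REAL-ZONE × CONSTANT REMAINDER AT SLOPE ≥ 0 ⟹ (2.6)–(2.9) FOR ALL PROFILES, WITHOUT (2.46)** (`r ≤ m − c₀θ₁^{k₁}(1+θ₁)`;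
NO continuity; the printed-type upper bound; run-side data). [cite: Balaban1988Convergent, (2.5)–(2.9) pp.255–256] -/
theorem realMarginConst_flowIneq_allProfiles {C : B12.Construction} (hgen : ForwardGenerated C β)
    (hhalt : HaltsOutside C β) (hcur : CurriesHBeta C β) (S : B12Beta.OneLoopSplit β) {P : ℕ → B12Beta.Kernel d}
    {μ ν : Fin d} (hP : ∀ k, PolarizationSign.MomentSummable (P k) 2)
    (hβ0 : ∀ k, S.β0 k = B12Beta.secondMoment (P k) μ ν) {γ₀ R ρ c θ M r β' m : ℝ} {k₁ : ℕ} (hγ₀ : 0 < γ₀)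
    (hR : 0 < R) (hρ : 0 < ρ) (hρR : ρ < R) (hc : 0 < c) (hθ0 : 0 < θ) (hθ1 : θ < 1)
    (hrate : RealStepRate P μ ν c θ) (hB : StripBound P μ ν R M) (hcM : c ≤ 2 * M)
    (hE : ∀ k, ∀ v ∈ ({Pi.single μ 1, Pi.single ν 1, Pi.single μ 1 + Pi.single ν 1} : Set (Fin d → ℤ)),
      MomentSymbol.ExpMoment (P k μ ν) v R)
    (hlist : ∀ k, k ≤ k₁ → m ≤ S.β0 k) (hrem : RemainderConst S γ₀ r)
    (hr : r ≤ m - 3 * (c ^ (1 - ρ / R) * (2 * M) ^ (ρ / R)) / ρ ^ 2 / (1 - θ ^ (1 - ρ / R))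
      * (θ ^ (1 - ρ / R)) ^ k₁ * (1 + θ ^ (1 - ρ / R)))
    (hup : BetaUpperH β' γ₀ β) (hβ' : 0 ≤ β') {β₀ : ℝ} (hβ₀ : 0 < β₀) {L : ℕ} (hL2 : 2 ≤ L) (p : ℕ) :
    ∃ γ₁ : ℝ, 0 < γ₁ ∧
      ∀ γ : ℝ, 0 < γ → γ ≤ min γ₀ γ₁ → ∀ Pr : B12.RunParams, (C Pr).flow.InInterval γ Pr.K →
        ∀ p' : ℕ, p' ≤ p → ∀ A₀ : ℝ, 0 ≤ A₀ →
          ∃ Rj : ℕ → ℕ, (∀ j, B14.IsRj L p' ((C Pr).flow.g j) (Rj j)) ∧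
            B14.FlowIneq26 (C Pr).flow.g β' β₀ Pr.K ∧ B14.FlowIneq27 (C Pr).flow.g β' β₀ p' Pr.K ∧
            B14.FlowIneq28 (epsK A₀ p' (C Pr).flow) (C Pr).flow.g β' β₀ Pr.K ∧
            B14FlowStep.FlowIneq29 Rj (C Pr).flow.g L β' β₀ Pr.K :=
  (betaAvgAFH_of_realMarginConst S hP hβ0 hR hρ hρR hc hθ0 hθ1 hrate hB hcM hE hlist hrem)
    |>.flowIneq_allProfiles (sub_nonneg.mpr hr) hgen hhalt hcur hγ₀ hβ' hβ₀ hL2 p hup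

/-- **REAL-ZONE × CONSTANT REMAINDER AT SLOPE ≥ 0 ⟹ THE T⁴ CELL's FLOW-FACT BINDERS** (census C19/C20; NO continuity).
[cite: Balaban1988Convergent, (2.5)–(2.9) pp.255–256] -/
theorem realMarginConst_t4FlowInputs {C : B12.Construction} (hgen : ForwardGenerated C β)
    (hhalt : HaltsOutside C β) (hcur : CurriesHBeta C β) (S : B12Beta.OneLoopSplit β) {P : ℕ → B12Beta.Kernel d}
    {μ ν : Fin d} (hP : ∀ k, PolarizationSign.MomentSummable (P k) 2)
    (hβ0 : ∀ k, S.β0 k = B12Beta.secondMoment (P k) μ ν) {γ₀ R ρ c θ M r β' m : ℝ} {k₁ : ℕ} (hγ₀ : 0 < γ₀)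
    (hR : 0 < R) (hρ : 0 < ρ) (hρR : ρ < R) (hc : 0 < c) (hθ0 : 0 < θ) (hθ1 : θ < 1)
    (hrate : RealStepRate P μ ν c θ) (hB : StripBound P μ ν R M) (hcM : c ≤ 2 * M)
    (hE : ∀ k, ∀ v ∈ ({Pi.single μ 1, Pi.single ν 1, Pi.single μ 1 + Pi.single ν 1} : Set (Fin d → ℤ)),
      MomentSymbol.ExpMoment (P k μ ν) v R)
    (hlist : ∀ k, k ≤ k₁ → m ≤ S.β0 k) (hrem : RemainderConst S γ₀ r)
    (hr : r ≤ m - 3 * (c ^ (1 - ρ / R) * (2 * M) ^ (ρ / R)) / ρ ^ 2 / (1 - θ ^ (1 - ρ / R))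
      * (θ ^ (1 - ρ / R)) ^ k₁ * (1 + θ ^ (1 - ρ / R)))
    (hup : BetaUpperH β' γ₀ β) (hβ' : 0 ≤ β') {β₀ : ℝ} (hβ₀ : 0 < β₀) {L : ℕ} (hL2 : 2 ≤ L) {p₀ r' : ℕ}
    (hr' : r' ≤ p₀) :
    ∃ γ₁ : ℝ, 0 < γ₁ ∧ ∀ γ : ℝ, 0 < γ → γ ≤ min γ₀ γ₁ → ∀ Pr : B12.RunParams, (C Pr).flow.InInterval γ Pr.K →
      B14.FlowIneq27 (C Pr).flow.g β' β₀ p₀ Pr.K ∧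
      (∀ j, j ≤ Pr.K → 1 ≤ Real.log (((C Pr).flow.g j) ^ 2)⁻¹) ∧
      ∃ Rj : ℕ → ℕ, (∀ j, B14.IsRj L r' ((C Pr).flow.g j) (Rj j)) ∧ B14FlowStep.FlowIneq29 Rj (C Pr).flow.g L β' β₀ Pr.K :=
  (betaAvgAFH_of_realMarginConst S hP hβ0 hR hρ hρR hc hθ0 hθ1 hrate hB hcM hE hlist hrem)
    |>.t4FlowInputs_of_nonneg (sub_nonneg.mpr hr) hgen hhalt hcur hγ₀ hβ' hβ₀ hL2 hr' hup

/-- **BLOCK-TRANSFER × CONSTANT REMAINDER ⟹ THE CARRIER, DEFECT ZERO** (at the LARGE one-loop block size): asym2's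
`betaLowerH_of_blockMarginConst` (small-block `CauchyRate b a θ`, `0 ≤ θ < 1`, `0 < n`; the composition hypothesis `hblock` — Q-asym1-5, a
binder; small-block block-sum certificates `m ≤ blockSum n b k`, `k ≤ k₁`; `RemainderConst S γ₀ r`) through `betaAvgAFH_of_betaLowerH`:
`BetaAvgAFH (m − a(Σ_{i<n}θ^i)²/(1−θⁿ)·(θⁿ)^{k₁}(1+θⁿ) − r) 0 γ₀ β`. [cite: Balaban1987RG1, (1.22) p.264 and (2.12)–(2.14) p.268] -/
theorem betaAvgAFH_of_blockMarginConst (S : B12Beta.OneLoopSplit β) {b : ℕ → ℝ} {n : ℕ} (hn : 0 < n)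
    (hblock : ∀ k, S.β0 k = blockSum n b k) {γ₀ a θ r m : ℝ} {k₁ : ℕ} (hθ0 : 0 ≤ θ) (hθ1 : θ < 1)
    (hrate : CauchyRate b a θ) (hlist : ∀ k, k ≤ k₁ → m ≤ blockSum n b k) (hrem : RemainderConst S γ₀ r) :
    BetaAvgAFH (m - a * (∑ i ∈ Finset.range n, θ ^ i) ^ 2 / (1 - θ ^ n) * (θ ^ n) ^ k₁ * (1 + θ ^ n) - r)
      0 γ₀ β :=
  betaAvgAFH_of_betaLowerH (betaLowerH_of_blockMarginConst S hn hblock hθ0 hθ1 hrate hlist hrem)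

/-- **BLOCK-TRANSFER × CONSTANT REMAINDER ⟹ THE END STATEMENT, [III] SIDE, ALL PROFILES**: the binders of asym2's
`thm2Printed_of_blockMarginConst` minus `L'`/`hL` (the DAG of the large-block construction, its split `S`, small-block Cauchy rate,
`hblock`, small-block certificates, `RemainderConst` (chain at the large block size) with `r < m − a(Σ_{i<n}θ^i)²/(1−θⁿ)·(θⁿ)^{k₁}(1+θⁿ)`
STRICTLY, (C), (U) with `β′ ≥ 0`) + the [III] run-side data (the radii base `L ≥ 2` of (2.5) is the [III]-side binder) ⟹
`EndpointExistence C ∧ ∃ γ₁ > 0, ∀ γ ≤ min γ₀ γ₁, ∀ runs in ]0,γ], ∀ p′ ≤ p, ∀ A₀ ≥ 0: sizes ∧ HorizonFacts` ((2.6)–(2.9) + (2.46)),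
every `β₀ > 0`. [cite: Balaban1987RG1, Thm 2 p.259, (1.22) p.264 and Thm 3 p.264]
[cite: Balaban1988Convergent, (2.5)–(2.9) pp.255–256, (2.28) p.259, (2.46) p.263] -/
theorem blockMarginConst_END_allProfiles {C : B12.Construction} (hgen : ForwardGenerated C β)
    (hhalt : HaltsOutside C β) (hcur : CurriesHBeta C β) (S : B12Beta.OneLoopSplit β) {b : ℕ → ℝ} {n : ℕ}
    (hn : 0 < n) (hblock : ∀ k, S.β0 k = blockSum n b k) {γ₀ a θ r β' m : ℝ} {k₁ : ℕ} (hγ₀ : 0 < γ₀)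
    (hθ0 : 0 ≤ θ) (hθ1 : θ < 1) (hrate : CauchyRate b a θ) (hlist : ∀ k, k ≤ k₁ → m ≤ blockSum n b k)
    (hrem : RemainderConst S γ₀ r)
    (hr : r < m - a * (∑ i ∈ Finset.range n, θ ^ i) ^ 2 / (1 - θ ^ n) * (θ ^ n) ^ k₁ * (1 + θ ^ n))
    (hcont : BetaContH γ₀ β) (hup : BetaUpperH β' γ₀ β) (hβ' : 0 ≤ β')
    {β₀ : ℝ} (hβ₀ : 0 < β₀) {L : ℕ} (hL2 : 2 ≤ L) (p : ℕ) {κ₀ : ℕ} (hκ : 6 ≤ κ₀) :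
    EndpointExistence C ∧ ∃ γ₁ : ℝ, 0 < γ₁ ∧
      ∀ γ : ℝ, 0 < γ → γ ≤ min γ₀ γ₁ → ∀ Pr : B12.RunParams, (C Pr).flow.InInterval γ Pr.K →
        ∀ p' : ℕ, p' ≤ p → ∀ A₀ : ℝ, 0 ≤ A₀ →
          ∃ Rj : ℕ → ℕ, (∀ j, B14.IsRj L p' ((C Pr).flow.g j) (Rj j)) ∧
            HorizonFacts (C Pr).flow β' β₀ A₀ L p' κ₀ Rj Pr.K :=
  (betaAvgAFH_of_blockMarginConst S hn hblock hθ0 hθ1 hrate hlist hrem).endpoint_and_flowControl_allProfiles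
    (sub_pos.mpr hr) hgen hhalt hcur hγ₀ hβ' hβ₀ hL2 p hcont hup hκ

/-- **BLOCK-TRANSFER × CONSTANT REMAINDER AT SLOPE ≥ 0 ⟹ (2.6)–(2.9) FOR ALL PROFILES, WITHOUT (2.46)** (`r ≤ …`; NO continuity).
[cite: Balaban1988Convergent, (2.5)–(2.9) pp.255–256] -/
theorem blockMarginConst_flowIneq_allProfiles {C : B12.Construction} (hgen : ForwardGenerated C β)
    (hhalt : HaltsOutside C β) (hcur : CurriesHBeta C β) (S : B12Beta.OneLoopSplit β) {b : ℕ → ℝ} {n : ℕ}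
    (hn : 0 < n) (hblock : ∀ k, S.β0 k = blockSum n b k) {γ₀ a θ r β' m : ℝ} {k₁ : ℕ} (hγ₀ : 0 < γ₀)
    (hθ0 : 0 ≤ θ) (hθ1 : θ < 1) (hrate : CauchyRate b a θ) (hlist : ∀ k, k ≤ k₁ → m ≤ blockSum n b k)
    (hrem : RemainderConst S γ₀ r)
    (hr : r ≤ m - a * (∑ i ∈ Finset.range n, θ ^ i) ^ 2 / (1 - θ ^ n) * (θ ^ n) ^ k₁ * (1 + θ ^ n))
    (hup : BetaUpperH β' γ₀ β) (hβ' : 0 ≤ β') {β₀ : ℝ} (hβ₀ : 0 < β₀) {L : ℕ} (hL2 : 2 ≤ L) (p : ℕ) :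
    ∃ γ₁ : ℝ, 0 < γ₁ ∧
      ∀ γ : ℝ, 0 < γ → γ ≤ min γ₀ γ₁ → ∀ Pr : B12.RunParams, (C Pr).flow.InInterval γ Pr.K →
        ∀ p' : ℕ, p' ≤ p → ∀ A₀ : ℝ, 0 ≤ A₀ →
          ∃ Rj : ℕ → ℕ, (∀ j, B14.IsRj L p' ((C Pr).flow.g j) (Rj j)) ∧
            B14.FlowIneq26 (C Pr).flow.g β' β₀ Pr.K ∧ B14.FlowIneq27 (C Pr).flow.g β' β₀ p' Pr.K ∧
            B14.FlowIneq28 (epsK A₀ p' (C Pr).flow) (C Pr).flow.g β' β₀ Pr.K ∧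
            B14FlowStep.FlowIneq29 Rj (C Pr).flow.g L β' β₀ Pr.K :=
  (betaAvgAFH_of_blockMarginConst S hn hblock hθ0 hθ1 hrate hlist hrem).flowIneq_allProfiles (sub_nonneg.mpr hr)
    hgen hhalt hcur hγ₀ hβ' hβ₀ hL2 p hup

/-- **BLOCK-TRANSFER × CONSTANT REMAINDER AT SLOPE ≥ 0 ⟹ THE T⁴ CELL's FLOW-FACT BINDERS** (C19/C20; NO continuity).
[cite: Balaban1988Convergent, (2.5)–(2.9) pp.255–256] -/
theorem blockMarginConst_t4FlowInputs {C : B12.Construction} (hgen : ForwardGenerated C β)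
    (hhalt : HaltsOutside C β) (hcur : CurriesHBeta C β) (S : B12Beta.OneLoopSplit β) {b : ℕ → ℝ} {n : ℕ}
    (hn : 0 < n) (hblock : ∀ k, S.β0 k = blockSum n b k) {γ₀ a θ r β' m : ℝ} {k₁ : ℕ} (hγ₀ : 0 < γ₀)
    (hθ0 : 0 ≤ θ) (hθ1 : θ < 1) (hrate : CauchyRate b a θ) (hlist : ∀ k, k ≤ k₁ → m ≤ blockSum n b k)
    (hrem : RemainderConst S γ₀ r)
    (hr : r ≤ m - a * (∑ i ∈ Finset.range n, θ ^ i) ^ 2 / (1 - θ ^ n) * (θ ^ n) ^ k₁ * (1 + θ ^ n))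
    (hup : BetaUpperH β' γ₀ β) (hβ' : 0 ≤ β') {β₀ : ℝ} (hβ₀ : 0 < β₀) {L : ℕ} (hL2 : 2 ≤ L) {p₀ r' : ℕ}
    (hr' : r' ≤ p₀) :
    ∃ γ₁ : ℝ, 0 < γ₁ ∧ ∀ γ : ℝ, 0 < γ → γ ≤ min γ₀ γ₁ → ∀ Pr : B12.RunParams, (C Pr).flow.InInterval γ Pr.K →
      B14.FlowIneq27 (C Pr).flow.g β' β₀ p₀ Pr.K ∧
      (∀ j, j ≤ Pr.K → 1 ≤ Real.log (((C Pr).flow.g j) ^ 2)⁻¹) ∧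
      ∃ Rj : ℕ → ℕ, (∀ j, B14.IsRj L r' ((C Pr).flow.g j) (Rj j)) ∧ B14FlowStep.FlowIneq29 Rj (C Pr).flow.g L β' β₀ Pr.K :=
  (betaAvgAFH_of_blockMarginConst S hn hblock hθ0 hθ1 hrate hlist hrem).t4FlowInputs_of_nonneg (sub_nonneg.mpr hr)
    hgen hhalt hcur hγ₀ hβ' hβ₀ hL2 hr' hup

/-- **Non-vacuity with a POSITIVE slope** on asym2's scale-DEPENDENT block witness (`RemainderConstCertified.Witness.blockMarginConst_nonvacuous`:
`β_{k+1} ≡ blockSum 3 (j ↦ 1 + (1/2)^j) k`, `β¹ ≡ 0`, `CauchyRate _ (1/2) (1/2)`, certificate `3 ≤ b₀ + b₁ + b₂` at `k₁ = 0`, `r = 0`): the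
block road's carrier exists with `0 < slope` (numerically `33/32`), so the `r <` END forms above are not about the empty family. [folklore] -/
theorem blockMarginConst_carrier_nonvacuous :
    ∃ (β : HBeta) (γ₀ s : ℝ), 0 < γ₀ ∧ 0 < s ∧ BetaAvgAFH s 0 γ₀ β := by
  obtain ⟨β, S, b, n, k₁, γ₀, a, θ, m, r, hn, hblock, hγ₀, hθ0, hθ1, hrate, hlist, hrem, hr, -⟩ :=
    RemainderConstCertified.Witness.blockMarginConst_nonvacuous
  exact ⟨β, γ₀, _, hγ₀, sub_pos.mpr hr, betaAvgAFH_of_blockMarginConst S hn hblock hθ0 hθ1 hrate hlist hrem⟩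

end RealBlock

/-! ## §6 (v1.3) The NEAR-SEQUENCE TRANSFER × CONSTANT roads on the [III] side (asym1 `RateCertificate` v1.7 §11; asym2
`RemainderConstCertified` v1.3 §9, p185430)

asym1's §11 replaces §10's composition EQUALITY `hblock` by the INEQUALITY `NearRate a b e ϑ := ∀ k, |b k − a k| ≤ e·ϑ^k` between a
COMPARISON sequence `a` (block sums of small-block one-loop coefficients, the composed scheme, a sibling construction …) and `S.β0`: for the
GENUINE block-size-`Lⁿ` B12 step it is asym1's located one-loop SCHEME-TRANSFER rate (Q-asym1-5 in inequality form; NOT printed, NEVER asserted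
— a binder; `e = 0` ⟺ `hblock`).  asym2's §9 puts the constant-form remainder in that slot: `betaLowerH_of_nearMarginConst` (`GeomRate a binf c₀ θ`,
`0 ≤ θ ≤ 1`, `NearRate a S.β0 e θ`, one-sided list `m ≤ a k` for `k ≤ k₁`, `RemainderConst S γ₀ r` ⟹ floor `m − e − (c₀+e)θ^{k₁}(1+θ) − r` on ALL
boxes) and `betaLowerH_of_blockNearMarginConst` (small-block `CauchyRate b a θ`, `0 ≤ θ < 1`, `0 < n`, `NearRate (blockSum n b) S.β0 e (θⁿ)`,
small-block block-sum certificates ⟹ floor `m − e − (a(Σ_{i<n}θ^i)²/(1−θⁿ) + e)(θⁿ)^{k₁}(1+θⁿ) − r`).  Here is the [III] side, exactly as in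
§4/§5: the DEFECT-ZERO carrier by `betaAvgAFH_of_betaLowerH` and the three consumers, binders = asym2's VERBATIM minus `L`/`hL` (resp. `L'`/`hL`)
plus the [III] run-side data.  Binder census: comparison rate / small-block Cauchy rate = the wall's (D1)+(D3) in rate clothing (O-asym1-1); `hnear`
= Q-asym1-5 (located, unprinted); lists = computational leaves (cap); `hrem` = (D4); `hcont` = (D5); `hup` printed-TYPE; `hgen`/`hhalt`/`hcur`
structural / run-side.  [folklore] composition of landed theorems by name; nothing of the series is discharged; NOT Theorem 2, NOT the wall. -/

section NearConst

open Literature.MathematicalPhysics.QuantumFieldTheory.Balaban1983to89.Beta.RateCertificate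
  (NearRate CauchyRate blockSum)

/-- **NEAR × CONSTANT REMAINDER ⟹ THE CARRIER, DEFECT ZERO**: asym2's `betaLowerH_of_nearMarginConst` through `betaAvgAFH_of_betaLowerH`:
`BetaAvgAFH (m − e − (c₀+e)θ^{k₁}(1+θ) − r) 0 γ₀ β`.  No (C), no upper
bound, no DAG, no threshold scale. [cite: Balaban1987RG1, (1.22) p.264 and (2.12)–(2.14) p.268] -/
theorem betaAvgAFH_of_nearMarginConst (S : B12Beta.OneLoopSplit β) {a : ℕ → ℝ} {γ₀ binf c₀ θ e r m : ℝ} {k₁ : ℕ}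
    (hθ0 : 0 ≤ θ) (hθ1 : θ ≤ 1) (hconv : GeomRate a binf c₀ θ) (hnear : NearRate a S.β0 e θ)
    (hlist : ∀ k, k ≤ k₁ → m ≤ a k) (hrem : RemainderConst S γ₀ r) :
    BetaAvgAFH (m - e - (c₀ + e) * θ ^ k₁ * (1 + θ) - r) 0 γ₀ β :=
  betaAvgAFH_of_betaLowerH (betaLowerH_of_nearMarginConst S hθ0 hθ1 hconv hnear hlist hrem)

/-- **NEAR × CONSTANT REMAINDER ⟹ THE END STATEMENT, [III] SIDE, ALL PROFILES**: the binders of asym2's `thm2Printed_of_nearMarginConst` minus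
`L`/`hL` (comparison rate, nearness, one-sided list on `a`, `RemainderConst` with `r < m − e − (c₀+e)θ^{k₁}(1+θ)` STRICTLY, (C), (U) with `β′ ≥ 0`)
+ the [III] run-side data ⟹ `EndpointExistence C ∧ ∃ γ₁ > 0, ∀ γ ≤ min γ₀ γ₁, ∀ runs in ]0,γ], ∀ p′ ≤ p, ∀ A₀ ≥ 0: sizes ∧ HorizonFacts`
((2.6)–(2.9) + (2.46)), every `β₀ > 0`. [cite: Balaban1987RG1, Thm 2 p.259, (1.22) p.264 and Thm 3 p.264]
[cite: Balaban1988Convergent, (2.5)–(2.9) pp.255–256, (2.28) p.259, (2.46) p.263] -/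
theorem nearMarginConst_END_allProfiles {C : B12.Construction} (hgen : ForwardGenerated C β)
    (hhalt : HaltsOutside C β) (hcur : CurriesHBeta C β) (S : B12Beta.OneLoopSplit β) {a : ℕ → ℝ}
    {γ₀ binf c₀ θ e r β' m : ℝ} {k₁ : ℕ} (hγ₀ : 0 < γ₀) (hθ0 : 0 ≤ θ) (hθ1 : θ ≤ 1) (hconv : GeomRate a binf c₀ θ)
    (hnear : NearRate a S.β0 e θ) (hlist : ∀ k, k ≤ k₁ → m ≤ a k) (hrem : RemainderConst S γ₀ r)
    (hr : r < m - e - (c₀ + e) * θ ^ k₁ * (1 + θ))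
    (hcont : BetaContH γ₀ β) (hup : BetaUpperH β' γ₀ β) (hβ' : 0 ≤ β')
    {β₀ : ℝ} (hβ₀ : 0 < β₀) {L : ℕ} (hL2 : 2 ≤ L) (p : ℕ) {κ₀ : ℕ} (hκ : 6 ≤ κ₀) :
    EndpointExistence C ∧ ∃ γ₁ : ℝ, 0 < γ₁ ∧
      ∀ γ : ℝ, 0 < γ → γ ≤ min γ₀ γ₁ → ∀ Pr : B12.RunParams, (C Pr).flow.InInterval γ Pr.K →
        ∀ p' : ℕ, p' ≤ p → ∀ A₀ : ℝ, 0 ≤ A₀ →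
          ∃ Rj : ℕ → ℕ, (∀ j, B14.IsRj L p' ((C Pr).flow.g j) (Rj j)) ∧
            HorizonFacts (C Pr).flow β' β₀ A₀ L p' κ₀ Rj Pr.K :=
  (betaAvgAFH_of_nearMarginConst S hθ0 hθ1 hconv hnear hlist hrem).endpoint_and_flowControl_allProfiles
    (sub_pos.mpr hr) hgen hhalt hcur hγ₀ hβ' hβ₀ hL2 p hcont hup hκ

/-- **NEAR × CONSTANT REMAINDER AT SLOPE ≥ 0 ⟹ (2.6)–(2.9) FOR ALL PROFILES, WITHOUT (2.46)** (`r ≤ …`; NO continuity).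
[cite: Balaban1988Convergent, (2.5)–(2.9) pp.255–256] -/
theorem nearMarginConst_flowIneq_allProfiles {C : B12.Construction} (hgen : ForwardGenerated C β)
    (hhalt : HaltsOutside C β) (hcur : CurriesHBeta C β) (S : B12Beta.OneLoopSplit β) {a : ℕ → ℝ}
    {γ₀ binf c₀ θ e r β' m : ℝ} {k₁ : ℕ} (hγ₀ : 0 < γ₀) (hθ0 : 0 ≤ θ) (hθ1 : θ ≤ 1) (hconv : GeomRate a binf c₀ θ)
    (hnear : NearRate a S.β0 e θ) (hlist : ∀ k, k ≤ k₁ → m ≤ a k) (hrem : RemainderConst S γ₀ r)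
    (hr : r ≤ m - e - (c₀ + e) * θ ^ k₁ * (1 + θ))
    (hup : BetaUpperH β' γ₀ β) (hβ' : 0 ≤ β') {β₀ : ℝ} (hβ₀ : 0 < β₀) {L : ℕ} (hL2 : 2 ≤ L) (p : ℕ) :
    ∃ γ₁ : ℝ, 0 < γ₁ ∧
      ∀ γ : ℝ, 0 < γ → γ ≤ min γ₀ γ₁ → ∀ Pr : B12.RunParams, (C Pr).flow.InInterval γ Pr.K →
        ∀ p' : ℕ, p' ≤ p → ∀ A₀ : ℝ, 0 ≤ A₀ →
          ∃ Rj : ℕ → ℕ, (∀ j, B14.IsRj L p' ((C Pr).flow.g j) (Rj j)) ∧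
            B14.FlowIneq26 (C Pr).flow.g β' β₀ Pr.K ∧ B14.FlowIneq27 (C Pr).flow.g β' β₀ p' Pr.K ∧
            B14.FlowIneq28 (epsK A₀ p' (C Pr).flow) (C Pr).flow.g β' β₀ Pr.K ∧
            B14FlowStep.FlowIneq29 Rj (C Pr).flow.g L β' β₀ Pr.K :=
  (betaAvgAFH_of_nearMarginConst S hθ0 hθ1 hconv hnear hlist hrem).flowIneq_allProfiles (sub_nonneg.mpr hr) hgen
    hhalt hcur hγ₀ hβ' hβ₀ hL2 p hup

/-- **NEAR × CONSTANT REMAINDER AT SLOPE ≥ 0 ⟹ THE T⁴ CELL's FLOW-FACT BINDERS** (C19/C20; NO continuity).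
[cite: Balaban1988Convergent, (2.5)–(2.9) pp.255–256] -/
theorem nearMarginConst_t4FlowInputs {C : B12.Construction} (hgen : ForwardGenerated C β)
    (hhalt : HaltsOutside C β) (hcur : CurriesHBeta C β) (S : B12Beta.OneLoopSplit β) {a : ℕ → ℝ}
    {γ₀ binf c₀ θ e r β' m : ℝ} {k₁ : ℕ} (hγ₀ : 0 < γ₀) (hθ0 : 0 ≤ θ) (hθ1 : θ ≤ 1) (hconv : GeomRate a binf c₀ θ)
    (hnear : NearRate a S.β0 e θ) (hlist : ∀ k, k ≤ k₁ → m ≤ a k) (hrem : RemainderConst S γ₀ r)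
    (hr : r ≤ m - e - (c₀ + e) * θ ^ k₁ * (1 + θ))
    (hup : BetaUpperH β' γ₀ β) (hβ' : 0 ≤ β') {β₀ : ℝ} (hβ₀ : 0 < β₀) {L : ℕ} (hL2 : 2 ≤ L) {p₀ r' : ℕ}
    (hr' : r' ≤ p₀) :
    ∃ γ₁ : ℝ, 0 < γ₁ ∧ ∀ γ : ℝ, 0 < γ → γ ≤ min γ₀ γ₁ → ∀ Pr : B12.RunParams, (C Pr).flow.InInterval γ Pr.K →
      B14.FlowIneq27 (C Pr).flow.g β' β₀ p₀ Pr.K ∧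
      (∀ j, j ≤ Pr.K → 1 ≤ Real.log (((C Pr).flow.g j) ^ 2)⁻¹) ∧
      ∃ Rj : ℕ → ℕ, (∀ j, B14.IsRj L r' ((C Pr).flow.g j) (Rj j)) ∧ B14FlowStep.FlowIneq29 Rj (C Pr).flow.g L β' β₀ Pr.K :=
  (betaAvgAFH_of_nearMarginConst S hθ0 hθ1 hconv hnear hlist hrem).t4FlowInputs_of_nonneg (sub_nonneg.mpr hr) hgen
    hhalt hcur hγ₀ hβ' hβ₀ hL2 hr' hup

/-- **BLOCK-NEAR × CONSTANT REMAINDER ⟹ THE CARRIER, DEFECT ZERO** (the GENUINE block-size-`Lⁿ` step from SMALL-block data): asym2's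
`betaLowerH_of_blockNearMarginConst` (small-block `CauchyRate b a θ`, `0 ≤ θ < 1`, `0 < n`; the located nearness
`NearRate (blockSum n b) S.β0 e (θⁿ)`; small-block block-sum certificates; `RemainderConst S γ₀ r`) through `betaAvgAFH_of_betaLowerH`.
[cite: Balaban1987RG1, (1.22) p.264 and (2.12)–(2.14) p.268] -/
theorem betaAvgAFH_of_blockNearMarginConst (S : B12Beta.OneLoopSplit β) {b : ℕ → ℝ} {n : ℕ} (hn : 0 < n)
    {γ₀ a θ e r m : ℝ} {k₁ : ℕ} (hθ0 : 0 ≤ θ) (hθ1 : θ < 1) (hrate : CauchyRate b a θ)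
    (hnear : NearRate (blockSum n b) S.β0 e (θ ^ n)) (hlist : ∀ k, k ≤ k₁ → m ≤ blockSum n b k)
    (hrem : RemainderConst S γ₀ r) :
    BetaAvgAFH (m - e - (a * (∑ i ∈ Finset.range n, θ ^ i) ^ 2 / (1 - θ ^ n) + e) * (θ ^ n) ^ k₁ * (1 + θ ^ n) - r) 0 γ₀ β :=
  betaAvgAFH_of_betaLowerH (betaLowerH_of_blockNearMarginConst S hn hθ0 hθ1 hrate hnear hlist hrem)

/-- **BLOCK-NEAR × CONSTANT REMAINDER ⟹ THE END STATEMENT, [III] SIDE, ALL PROFILES**: the binders of asym2's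
`thm2Printed_of_blockNearMarginConst` minus `L'`/`hL` (the DAG of the large-block construction, its split, small-block Cauchy rate, the located
nearness, small-block certificates, `RemainderConst` (chain at the large block size) with `r <` the block-near slope STRICTLY, (C), (U) with `β′ ≥ 0`)
+ the [III] run-side data (radii base `L ≥ 2` = the [III]-side binder) ⟹ `EndpointExistence C ∧ ∃ γ₁ > 0, …: sizes ∧ HorizonFacts`, every `β₀ > 0`.
[cite: Balaban1987RG1, Thm 2 p.259, (1.22) p.264 and Thm 3 p.264] [cite: Balaban1988Convergent, (2.5)–(2.9) pp.255–256, (2.28) p.259, (2.46) p.263] -/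
theorem blockNearMarginConst_END_allProfiles {C : B12.Construction} (hgen : ForwardGenerated C β)
    (hhalt : HaltsOutside C β) (hcur : CurriesHBeta C β) (S : B12Beta.OneLoopSplit β) {b : ℕ → ℝ} {n : ℕ}
    (hn : 0 < n) {γ₀ a θ e r β' m : ℝ} {k₁ : ℕ} (hγ₀ : 0 < γ₀) (hθ0 : 0 ≤ θ) (hθ1 : θ < 1) (hrate : CauchyRate b a θ)
    (hnear : NearRate (blockSum n b) S.β0 e (θ ^ n)) (hlist : ∀ k, k ≤ k₁ → m ≤ blockSum n b k)
    (hrem : RemainderConst S γ₀ r)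
    (hr : r < m - e - (a * (∑ i ∈ Finset.range n, θ ^ i) ^ 2 / (1 - θ ^ n) + e) * (θ ^ n) ^ k₁ * (1 + θ ^ n))
    (hcont : BetaContH γ₀ β) (hup : BetaUpperH β' γ₀ β) (hβ' : 0 ≤ β')
    {β₀ : ℝ} (hβ₀ : 0 < β₀) {L : ℕ} (hL2 : 2 ≤ L) (p : ℕ) {κ₀ : ℕ} (hκ : 6 ≤ κ₀) :
    EndpointExistence C ∧ ∃ γ₁ : ℝ, 0 < γ₁ ∧
      ∀ γ : ℝ, 0 < γ → γ ≤ min γ₀ γ₁ → ∀ Pr : B12.RunParams, (C Pr).flow.InInterval γ Pr.K →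
        ∀ p' : ℕ, p' ≤ p → ∀ A₀ : ℝ, 0 ≤ A₀ →
          ∃ Rj : ℕ → ℕ, (∀ j, B14.IsRj L p' ((C Pr).flow.g j) (Rj j)) ∧
            HorizonFacts (C Pr).flow β' β₀ A₀ L p' κ₀ Rj Pr.K :=
  (betaAvgAFH_of_blockNearMarginConst S hn hθ0 hθ1 hrate hnear hlist hrem).endpoint_and_flowControl_allProfiles
    (sub_pos.mpr hr) hgen hhalt hcur hγ₀ hβ' hβ₀ hL2 p hcont hup hκ

/-- **BLOCK-NEAR × CONSTANT REMAINDER AT SLOPE ≥ 0 ⟹ (2.6)–(2.9) FOR ALL PROFILES, WITHOUT (2.46)** (`r ≤ …`; NO continuity).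
[cite: Balaban1988Convergent, (2.5)–(2.9) pp.255–256] -/
theorem blockNearMarginConst_flowIneq_allProfiles {C : B12.Construction} (hgen : ForwardGenerated C β)
    (hhalt : HaltsOutside C β) (hcur : CurriesHBeta C β) (S : B12Beta.OneLoopSplit β) {b : ℕ → ℝ} {n : ℕ}
    (hn : 0 < n) {γ₀ a θ e r β' m : ℝ} {k₁ : ℕ} (hγ₀ : 0 < γ₀) (hθ0 : 0 ≤ θ) (hθ1 : θ < 1) (hrate : CauchyRate b a θ)
    (hnear : NearRate (blockSum n b) S.β0 e (θ ^ n)) (hlist : ∀ k, k ≤ k₁ → m ≤ blockSum n b k)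
    (hrem : RemainderConst S γ₀ r)
    (hr : r ≤ m - e - (a * (∑ i ∈ Finset.range n, θ ^ i) ^ 2 / (1 - θ ^ n) + e) * (θ ^ n) ^ k₁ * (1 + θ ^ n))
    (hup : BetaUpperH β' γ₀ β) (hβ' : 0 ≤ β') {β₀ : ℝ} (hβ₀ : 0 < β₀) {L : ℕ} (hL2 : 2 ≤ L) (p : ℕ) :
    ∃ γ₁ : ℝ, 0 < γ₁ ∧
      ∀ γ : ℝ, 0 < γ → γ ≤ min γ₀ γ₁ → ∀ Pr : B12.RunParams, (C Pr).flow.InInterval γ Pr.K →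
        ∀ p' : ℕ, p' ≤ p → ∀ A₀ : ℝ, 0 ≤ A₀ →
          ∃ Rj : ℕ → ℕ, (∀ j, B14.IsRj L p' ((C Pr).flow.g j) (Rj j)) ∧
            B14.FlowIneq26 (C Pr).flow.g β' β₀ Pr.K ∧ B14.FlowIneq27 (C Pr).flow.g β' β₀ p' Pr.K ∧
            B14.FlowIneq28 (epsK A₀ p' (C Pr).flow) (C Pr).flow.g β' β₀ Pr.K ∧
            B14FlowStep.FlowIneq29 Rj (C Pr).flow.g L β' β₀ Pr.K :=
  (betaAvgAFH_of_blockNearMarginConst S hn hθ0 hθ1 hrate hnear hlist hrem).flowIneq_allProfiles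
    (sub_nonneg.mpr hr) hgen hhalt hcur hγ₀ hβ' hβ₀ hL2 p hup

/-- **BLOCK-NEAR × CONSTANT REMAINDER AT SLOPE ≥ 0 ⟹ THE T⁴ CELL's FLOW-FACT BINDERS** (C19/C20; NO continuity).
[cite: Balaban1988Convergent, (2.5)–(2.9) pp.255–256] -/
theorem blockNearMarginConst_t4FlowInputs {C : B12.Construction} (hgen : ForwardGenerated C β)
    (hhalt : HaltsOutside C β) (hcur : CurriesHBeta C β) (S : B12Beta.OneLoopSplit β) {b : ℕ → ℝ} {n : ℕ}
    (hn : 0 < n) {γ₀ a θ e r β' m : ℝ} {k₁ : ℕ} (hγ₀ : 0 < γ₀) (hθ0 : 0 ≤ θ) (hθ1 : θ < 1) (hrate : CauchyRate b a θ)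
    (hnear : NearRate (blockSum n b) S.β0 e (θ ^ n)) (hlist : ∀ k, k ≤ k₁ → m ≤ blockSum n b k)
    (hrem : RemainderConst S γ₀ r)
    (hr : r ≤ m - e - (a * (∑ i ∈ Finset.range n, θ ^ i) ^ 2 / (1 - θ ^ n) + e) * (θ ^ n) ^ k₁ * (1 + θ ^ n))
    (hup : BetaUpperH β' γ₀ β) (hβ' : 0 ≤ β') {β₀ : ℝ} (hβ₀ : 0 < β₀) {L : ℕ} (hL2 : 2 ≤ L) {p₀ r' : ℕ}
    (hr' : r' ≤ p₀) :
    ∃ γ₁ : ℝ, 0 < γ₁ ∧ ∀ γ : ℝ, 0 < γ → γ ≤ min γ₀ γ₁ → ∀ Pr : B12.RunParams, (C Pr).flow.InInterval γ Pr.K →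
      B14.FlowIneq27 (C Pr).flow.g β' β₀ p₀ Pr.K ∧
      (∀ j, j ≤ Pr.K → 1 ≤ Real.log (((C Pr).flow.g j) ^ 2)⁻¹) ∧
      ∃ Rj : ℕ → ℕ, (∀ j, B14.IsRj L r' ((C Pr).flow.g j) (Rj j)) ∧ B14FlowStep.FlowIneq29 Rj (C Pr).flow.g L β' β₀ Pr.K :=
  (betaAvgAFH_of_blockNearMarginConst S hn hθ0 hθ1 hrate hnear hlist hrem).t4FlowInputs_of_nonneg
    (sub_nonneg.mpr hr) hgen hhalt hcur hγ₀ hβ' hβ₀ hL2 hr' hup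

/-- **Non-vacuity with a POSITIVE slope and a GENUINE nearness** (`e = 1/4`, `S.β0 ≠ a`; asym2's
`RemainderConstCertified.Witness.nearMarginConst_nonvacuous`, slope `3/8`): the near road's carrier exists with `0 < slope`. [folklore] -/
theorem nearMarginConst_carrier_nonvacuous :
    ∃ (β : HBeta) (γ₀ s : ℝ), 0 < γ₀ ∧ 0 < s ∧ BetaAvgAFH s 0 γ₀ β := by
  obtain ⟨β, S, a, k₁, γ₀, binf, c₀, θ, e, m, r, hγ₀, hθ0, hθ1, hconv, hnear, hlist, hrem, hr, -⟩ :=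
    RemainderConstCertified.Witness.nearMarginConst_nonvacuous
  exact ⟨β, γ₀, _, hγ₀, sub_pos.mpr hr, betaAvgAFH_of_nearMarginConst S hθ0 hθ1 hconv hnear hlist hrem⟩

end NearConst

/-! ## §7 (v1.4) The CUMULATIVE (PARTIAL-SUM) SCHEME / L-TRANSFER DEFECT × CONSTANT roads on the [III] side (asym2 `RemainderConstCertified`
v1.4 §10, p185869; the β-level side of the lead's RULING (R19) «L-transfer ⊂ (D1)», kernel `ScalewiseVectorSeam.lTransfer_flowSum_le_of_hU`)

asym2's §10 replaces §9's DECAYING nearness by the CUMULATIVE one, `CumNear a b Γ := ∀ k, |Σ_{j<k} b j − Σ_{j<k} a j| ≤ Γ` — the grade of the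
wall's (D1) full-sum binder and of the (R19) conclusion `∀ m ≥ 1, |Σ_{j<n·m} β₁⁰ j − Σ_{j<m} β₂⁰ j| ≤ U₁ + U₂` (`cumNear_blockSum_of_flowSums`, pure
re-indexing; for the genuine base-`L` / base-`Lⁿ` pair it is an2's telescoped scheme term, a LOCATED READING (GAPS C-an2-52 (3)), never a hypothesis of
a statement) — and distinguishes two grades.  END grade: the comparison rate gives the drift of `a` (`GeomRate.drift`), `CumNear` transports it to
`S.β0` with defect `+ Γ` (`oneLoopDrift_of_cumNear`), and NO condition relates `Γ` to the margin — the kernel form, on the certified road, of (R19-1)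
«at EXISTENCE grade the L-transfer is not a new item».  On the [III] side this is the DRIFT carrier of `AveragedAFCarrier` §Sources
(`betaAvgAFH_of_driftRemainderConst`: slope `binf − r`, defect `2(c₀/(1−θ) + Γ)`): the located [III] list needs only `0 < slope`, i.e. `r < binf`,
located by ONE certified value `m ≤ a k₁` and `r < m − c₀θ^{k₁}` (`GeomRate.binf_ge`); the defect moves `γ₁`, nothing else
(`BetaAvgAFH.endpoint_and_flowControl_allProfiles` is uniform in `D`).  Theorem-2 grade: `CumNear.lower` (`a k − 2Γ ≤ S.β0 k`) puts `2Γ` INTO the floor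
(`betaLowerH_of_cumNearMarginConst`), so the defect-zero [III] carrier has slope `m − c₀θ^{k₁}(1+θ) − 2Γ − r` and `Γ` IS paid against the certified
margin — (R19-3)'s certificate question (owners cap / num; evidence grade (R15); nothing supplied here).  Binders = asym2's VERBATIM plus the [III]
run-side data; census: `hconv`/`hrate` asym1 for the COMPARISON sequence (LOCATED-UNPRINTED, O-asym1-1); `hcum`/`hLT` the cumulative scheme / L-transfer
defect (LOCATED; (D1) twice per (R19-1)); `hcert`/`hlist` cap (COMPUTATIONAL LEAVES for `a`, lower values only); `hrem` (D4); `hcont` (C) (D5); `hup`/`hβ'`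
(U); `hgen`/`hhalt`/`hcur` structural / run-side.  [folklore] composition of landed theorems by name; the seam module is NOT imported (any supplier of
the (R19) shape plugs into `hLT`); nothing of the series is discharged; NOT Theorem 2, NOT the wall, NOT continuum, NOT Clay. -/

section CumulativeConst

open Literature.MathematicalPhysics.QuantumFieldTheory.Balaban1983to89.Beta.RateCertificate
  (CauchyRate blockSum cauchyRate_blockSum)

/-- **CUMULATIVE DEFECT × CONSTANT REMAINDER ⟹ THE DRIFT CARRIER** (END grade, NO condition on `Γ`): the comparison rate `GeomRate a binf c₀ θ`
(`0 ≤ θ < 1`), `CumNear a S.β0 Γ` and `RemainderConst S γ₀ r` give `BetaAvgAFH (binf − r) (2(c₀/(1−θ) + Γ)) γ₀ β` — asym2's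
`oneLoopDrift_of_cumNear` through `betaAvgAFH_of_driftRemainderConst`.  Slope = the comparison limit minus the remainder constant (never
identified, never signed here); `Γ` in the DEFECT only. [cite: Balaban1987RG1, (1.22) p.264 and (2.12)–(2.14) p.268] -/
theorem betaAvgAFH_of_cumNearConst (S : B12Beta.OneLoopSplit β) {a : ℕ → ℝ} {γ₀ binf c₀ θ Γ r : ℝ} (hθ0 : 0 ≤ θ)
    (hθ1 : θ < 1) (hconv : GeomRate a binf c₀ θ) (hcum : CumNear a S.β0 Γ) (hrem : RemainderConst S γ₀ r) :
    BetaAvgAFH (binf - r) (2 * (c₀ / (1 - θ) + Γ)) γ₀ β :=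
  betaAvgAFH_of_driftRemainderConst S (oneLoopDrift_of_cumNear S hθ0 hθ1 hconv hcum) hrem

/-- **CUMULATIVE DEFECT × CONSTANT REMAINDER ⟹ THE END STATEMENT, [III] SIDE, ALL PROFILES** (END grade, NO condition on `Γ`): the binders of
asym2's `endpointExistence_of_cumNearConst` (comparison rate with `θ < 1`, ONE certified value `m ≤ a k₁`, `CumNear a S.β0 Γ`, `RemainderConst` with
`r < m − c₀θ^{k₁}` STRICTLY — so `0 < binf − r` by `GeomRate.binf_ge` —, (U) with `β′ ≥ 0`, (C)) + the [III] run-side data ⟹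
`EndpointExistence C ∧ ∃ γ₁ > 0, ∀ γ ≤ min γ₀ γ₁, ∀ runs in ]0,γ], ∀ p′ ≤ p, ∀ A₀ ≥ 0: sizes ∧ HorizonFacts` ((2.6)–(2.9) + (2.46)), every `β₀ > 0`.
[cite: Balaban1987RG1, Thm 2 p.259, (1.22) p.264 and Thm 3 p.264]
[cite: Balaban1988Convergent, (2.5)–(2.9) pp.255–256, (2.28) p.259, (2.46) p.263] -/
theorem cumNearConst_END_allProfiles {C : B12.Construction} (hgen : ForwardGenerated C β)
    (hhalt : HaltsOutside C β) (hcur : CurriesHBeta C β) (S : B12Beta.OneLoopSplit β) {a : ℕ → ℝ}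
    {γ₀ binf c₀ θ Γ r β' m : ℝ} {k₁ : ℕ} (hγ₀ : 0 < γ₀) (hθ0 : 0 ≤ θ) (hθ1 : θ < 1) (hconv : GeomRate a binf c₀ θ)
    (hcert : m ≤ a k₁) (hcum : CumNear a S.β0 Γ) (hrem : RemainderConst S γ₀ r) (hr : r < m - c₀ * θ ^ k₁)
    (hcont : BetaContH γ₀ β) (hup : BetaUpperH β' γ₀ β) (hβ' : 0 ≤ β')
    {β₀ : ℝ} (hβ₀ : 0 < β₀) {L : ℕ} (hL2 : 2 ≤ L) (p : ℕ) {κ₀ : ℕ} (hκ : 6 ≤ κ₀) :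
    EndpointExistence C ∧ ∃ γ₁ : ℝ, 0 < γ₁ ∧
      ∀ γ : ℝ, 0 < γ → γ ≤ min γ₀ γ₁ → ∀ Pr : B12.RunParams, (C Pr).flow.InInterval γ Pr.K →
        ∀ p' : ℕ, p' ≤ p → ∀ A₀ : ℝ, 0 ≤ A₀ →
          ∃ Rj : ℕ → ℕ, (∀ j, B14.IsRj L p' ((C Pr).flow.g j) (Rj j)) ∧
            HorizonFacts (C Pr).flow β' β₀ A₀ L p' κ₀ Rj Pr.K :=
  (betaAvgAFH_of_cumNearConst S hθ0 hθ1 hconv hcum hrem).endpoint_and_flowControl_allProfiles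
    (sub_pos.mpr (hr.trans_le (hconv.binf_ge hcert))) hgen hhalt hcur hγ₀ hβ' hβ₀ hL2 p hcont hup hκ

/-- **CUMULATIVE DEFECT × CONSTANT REMAINDER AT SLOPE ≥ 0 ⟹ (2.6)–(2.9) FOR ALL PROFILES, WITHOUT (2.46)** (`r ≤ m − c₀θ^{k₁}`; NO continuity).
[cite: Balaban1988Convergent, (2.5)–(2.9) pp.255–256] -/
theorem cumNearConst_flowIneq_allProfiles {C : B12.Construction} (hgen : ForwardGenerated C β)
    (hhalt : HaltsOutside C β) (hcur : CurriesHBeta C β) (S : B12Beta.OneLoopSplit β) {a : ℕ → ℝ}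
    {γ₀ binf c₀ θ Γ r β' m : ℝ} {k₁ : ℕ} (hγ₀ : 0 < γ₀) (hθ0 : 0 ≤ θ) (hθ1 : θ < 1) (hconv : GeomRate a binf c₀ θ)
    (hcert : m ≤ a k₁) (hcum : CumNear a S.β0 Γ) (hrem : RemainderConst S γ₀ r) (hr : r ≤ m - c₀ * θ ^ k₁)
    (hup : BetaUpperH β' γ₀ β) (hβ' : 0 ≤ β') {β₀ : ℝ} (hβ₀ : 0 < β₀) {L : ℕ} (hL2 : 2 ≤ L) (p : ℕ) :
    ∃ γ₁ : ℝ, 0 < γ₁ ∧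
      ∀ γ : ℝ, 0 < γ → γ ≤ min γ₀ γ₁ → ∀ Pr : B12.RunParams, (C Pr).flow.InInterval γ Pr.K →
        ∀ p' : ℕ, p' ≤ p → ∀ A₀ : ℝ, 0 ≤ A₀ →
          ∃ Rj : ℕ → ℕ, (∀ j, B14.IsRj L p' ((C Pr).flow.g j) (Rj j)) ∧
            B14.FlowIneq26 (C Pr).flow.g β' β₀ Pr.K ∧ B14.FlowIneq27 (C Pr).flow.g β' β₀ p' Pr.K ∧
            B14.FlowIneq28 (epsK A₀ p' (C Pr).flow) (C Pr).flow.g β' β₀ Pr.K ∧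
            B14FlowStep.FlowIneq29 Rj (C Pr).flow.g L β' β₀ Pr.K :=
  (betaAvgAFH_of_cumNearConst S hθ0 hθ1 hconv hcum hrem).flowIneq_allProfiles
    (sub_nonneg.mpr (hr.trans (hconv.binf_ge hcert))) hgen hhalt hcur hγ₀ hβ' hβ₀ hL2 p hup

/-- **CUMULATIVE DEFECT × CONSTANT REMAINDER AT SLOPE ≥ 0 ⟹ THE T⁴ CELL's FLOW-FACT BINDERS** (C19/C20; NO continuity).
[cite: Balaban1988Convergent, (2.5)–(2.9) pp.255–256] -/
theorem cumNearConst_t4FlowInputs {C : B12.Construction} (hgen : ForwardGenerated C β)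
    (hhalt : HaltsOutside C β) (hcur : CurriesHBeta C β) (S : B12Beta.OneLoopSplit β) {a : ℕ → ℝ}
    {γ₀ binf c₀ θ Γ r β' m : ℝ} {k₁ : ℕ} (hγ₀ : 0 < γ₀) (hθ0 : 0 ≤ θ) (hθ1 : θ < 1) (hconv : GeomRate a binf c₀ θ)
    (hcert : m ≤ a k₁) (hcum : CumNear a S.β0 Γ) (hrem : RemainderConst S γ₀ r) (hr : r ≤ m - c₀ * θ ^ k₁)
    (hup : BetaUpperH β' γ₀ β) (hβ' : 0 ≤ β') {β₀ : ℝ} (hβ₀ : 0 < β₀) {L : ℕ} (hL2 : 2 ≤ L) {p₀ r' : ℕ}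
    (hr' : r' ≤ p₀) :
    ∃ γ₁ : ℝ, 0 < γ₁ ∧ ∀ γ : ℝ, 0 < γ → γ ≤ min γ₀ γ₁ → ∀ Pr : B12.RunParams, (C Pr).flow.InInterval γ Pr.K →
      B14.FlowIneq27 (C Pr).flow.g β' β₀ p₀ Pr.K ∧
      (∀ j, j ≤ Pr.K → 1 ≤ Real.log (((C Pr).flow.g j) ^ 2)⁻¹) ∧
      ∃ Rj : ℕ → ℕ, (∀ j, B14.IsRj L r' ((C Pr).flow.g j) (Rj j)) ∧ B14FlowStep.FlowIneq29 Rj (C Pr).flow.g L β' β₀ Pr.K :=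
  (betaAvgAFH_of_cumNearConst S hθ0 hθ1 hconv hcum hrem).t4FlowInputs_of_nonneg
    (sub_nonneg.mpr (hr.trans (hconv.binf_ge hcert))) hgen hhalt hcur hγ₀ hβ' hβ₀ hL2 hr' hup

/-- **THE LARGE BLOCK SIZE FROM SMALL-BLOCK DATA AND THE CUMULATIVE DEFECT ⟹ THE END STATEMENT, [III] SIDE** (END grade, NO condition on
`Γ`): the binders of asym2's `endpointExistence_of_blockCumNearConst` (small-block `CauchyRate b c θ`, `0 ≤ θ < 1`, `0 < n`; ONE block-sum certificate
`m ≤ blockSum n b k₁`; `CumNear (blockSum n b) S.β0 Γ`; `RemainderConst S γ₀ r` AT the construction's block size with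
`r < m − c(Σ_{i<n}θ^i)²/(1−θⁿ)·(θⁿ)^{k₁}` STRICTLY; (U), (C)) + the [III] run-side data (radii base `L ≥ 2` = the [III]-side binder).
[cite: Balaban1987RG1, Thm 2 p.259, (1.22) p.264 and Thm 3 p.264]
[cite: Balaban1988Convergent, (2.5)–(2.9) pp.255–256, (2.28) p.259, (2.46) p.263] -/
theorem blockCumNearConst_END_allProfiles {C : B12.Construction} (hgen : ForwardGenerated C β)
    (hhalt : HaltsOutside C β) (hcur : CurriesHBeta C β) (S : B12Beta.OneLoopSplit β) {b : ℕ → ℝ} {n : ℕ}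
    (hn : 0 < n) {γ₀ c θ Γ r β' m : ℝ} {k₁ : ℕ} (hγ₀ : 0 < γ₀) (hθ0 : 0 ≤ θ) (hθ1 : θ < 1)
    (hrate : CauchyRate b c θ) (hcert : m ≤ blockSum n b k₁) (hcum : CumNear (blockSum n b) S.β0 Γ)
    (hrem : RemainderConst S γ₀ r)
    (hr : r < m - c * (∑ i ∈ Finset.range n, θ ^ i) ^ 2 / (1 - θ ^ n) * (θ ^ n) ^ k₁)
    (hcont : BetaContH γ₀ β) (hup : BetaUpperH β' γ₀ β) (hβ' : 0 ≤ β')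
    {β₀ : ℝ} (hβ₀ : 0 < β₀) {L : ℕ} (hL2 : 2 ≤ L) (p : ℕ) {κ₀ : ℕ} (hκ : 6 ≤ κ₀) :
    EndpointExistence C ∧ ∃ γ₁ : ℝ, 0 < γ₁ ∧
      ∀ γ : ℝ, 0 < γ → γ ≤ min γ₀ γ₁ → ∀ Pr : B12.RunParams, (C Pr).flow.InInterval γ Pr.K →
        ∀ p' : ℕ, p' ≤ p → ∀ A₀ : ℝ, 0 ≤ A₀ →
          ∃ Rj : ℕ → ℕ, (∀ j, B14.IsRj L p' ((C Pr).flow.g j) (Rj j)) ∧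
            HorizonFacts (C Pr).flow β' β₀ A₀ L p' κ₀ Rj Pr.K :=
  have hθ1' : θ ^ n < 1 := pow_lt_one₀ hθ0 hθ1 hn.ne'
  cumNearConst_END_allProfiles hgen hhalt hcur S hγ₀ (pow_nonneg hθ0 n) hθ1'
    ((cauchyRate_blockSum hrate n).geomRate hθ1') hcert hcum hrem hr hcont hup hβ' hβ₀ hL2 p hκ

/-- **… with the (R19) CONCLUSION SHAPE ITSELF as the transfer binder** — the [III]-side twin of asym2's `endpointExistence_of_lTransferConst`:
`hLT : ∀ m′ ≥ 1, |Σ_{j<n·m′} b j − Σ_{j<m′} S.β0 j| ≤ U` (`β₁⁰ = b` at the small block size, `β₂⁰ = S.β0` at block size `Lⁿ`; `U = U₁ + U₂` when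
supplied by the lead's `ScalewiseVectorSeam.lTransfer_flowSum_le_of_hU` from two (D1) full-sum binders — RULING (R19-1) «(D1) twice») composed to the
located [III] list with NO further numeric condition on `U` (`cumNear_blockSum_of_flowSums`). [cite: Balaban1987RG1, Thm 2 p.259, (1.22) p.264 and Thm 3 p.264]
[cite: Balaban1988Convergent, (2.5)–(2.9) pp.255–256, (2.28) p.259, (2.46) p.263] -/
theorem lTransferConst_END_allProfiles {C : B12.Construction} (hgen : ForwardGenerated C β)
    (hhalt : HaltsOutside C β) (hcur : CurriesHBeta C β) (S : B12Beta.OneLoopSplit β) {b : ℕ → ℝ} {n : ℕ}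
    (hn : 0 < n) {γ₀ c θ U r β' m : ℝ} {k₁ : ℕ} (hγ₀ : 0 < γ₀) (hθ0 : 0 ≤ θ) (hθ1 : θ < 1)
    (hrate : CauchyRate b c θ) (hcert : m ≤ blockSum n b k₁)
    (hLT : ∀ m' : ℕ, 1 ≤ m' → |∑ j ∈ Finset.range (n * m'), b j - ∑ j ∈ Finset.range m', S.β0 j| ≤ U)
    (hrem : RemainderConst S γ₀ r)
    (hr : r < m - c * (∑ i ∈ Finset.range n, θ ^ i) ^ 2 / (1 - θ ^ n) * (θ ^ n) ^ k₁)
    (hcont : BetaContH γ₀ β) (hup : BetaUpperH β' γ₀ β) (hβ' : 0 ≤ β')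
    {β₀ : ℝ} (hβ₀ : 0 < β₀) {L : ℕ} (hL2 : 2 ≤ L) (p : ℕ) {κ₀ : ℕ} (hκ : 6 ≤ κ₀) :
    EndpointExistence C ∧ ∃ γ₁ : ℝ, 0 < γ₁ ∧
      ∀ γ : ℝ, 0 < γ → γ ≤ min γ₀ γ₁ → ∀ Pr : B12.RunParams, (C Pr).flow.InInterval γ Pr.K →
        ∀ p' : ℕ, p' ≤ p → ∀ A₀ : ℝ, 0 ≤ A₀ →
          ∃ Rj : ℕ → ℕ, (∀ j, B14.IsRj L p' ((C Pr).flow.g j) (Rj j)) ∧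
            HorizonFacts (C Pr).flow β' β₀ A₀ L p' κ₀ Rj Pr.K :=
  blockCumNearConst_END_allProfiles hgen hhalt hcur S hn hγ₀ hθ0 hθ1 hrate hcert (cumNear_blockSum_of_flowSums hLT)
    hrem hr hcont hup hβ' hβ₀ hL2 p hκ

/-- **… and the T⁴ cell's flow-fact binders from the (R19) shape at slope ≥ 0** (`r ≤ …`; C19/C20; NO continuity).
[cite: Balaban1988Convergent, (2.5)–(2.9) pp.255–256] -/
theorem lTransferConst_t4FlowInputs {C : B12.Construction} (hgen : ForwardGenerated C β)
    (hhalt : HaltsOutside C β) (hcur : CurriesHBeta C β) (S : B12Beta.OneLoopSplit β) {b : ℕ → ℝ} {n : ℕ}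
    (hn : 0 < n) {γ₀ c θ U r β' m : ℝ} {k₁ : ℕ} (hγ₀ : 0 < γ₀) (hθ0 : 0 ≤ θ) (hθ1 : θ < 1)
    (hrate : CauchyRate b c θ) (hcert : m ≤ blockSum n b k₁)
    (hLT : ∀ m' : ℕ, 1 ≤ m' → |∑ j ∈ Finset.range (n * m'), b j - ∑ j ∈ Finset.range m', S.β0 j| ≤ U)
    (hrem : RemainderConst S γ₀ r)
    (hr : r ≤ m - c * (∑ i ∈ Finset.range n, θ ^ i) ^ 2 / (1 - θ ^ n) * (θ ^ n) ^ k₁)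
    (hup : BetaUpperH β' γ₀ β) (hβ' : 0 ≤ β') {β₀ : ℝ} (hβ₀ : 0 < β₀) {L : ℕ} (hL2 : 2 ≤ L) {p₀ r' : ℕ}
    (hr' : r' ≤ p₀) :
    ∃ γ₁ : ℝ, 0 < γ₁ ∧ ∀ γ : ℝ, 0 < γ → γ ≤ min γ₀ γ₁ → ∀ Pr : B12.RunParams, (C Pr).flow.InInterval γ Pr.K →
      B14.FlowIneq27 (C Pr).flow.g β' β₀ p₀ Pr.K ∧
      (∀ j, j ≤ Pr.K → 1 ≤ Real.log (((C Pr).flow.g j) ^ 2)⁻¹) ∧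
      ∃ Rj : ℕ → ℕ, (∀ j, B14.IsRj L r' ((C Pr).flow.g j) (Rj j)) ∧ B14FlowStep.FlowIneq29 Rj (C Pr).flow.g L β' β₀ Pr.K :=
  have hθ1' : θ ^ n < 1 := pow_lt_one₀ hθ0 hθ1 hn.ne'
  cumNearConst_t4FlowInputs hgen hhalt hcur S hγ₀ (pow_nonneg hθ0 n) hθ1' ((cauchyRate_blockSum hrate n).geomRate hθ1')
    hcert (cumNear_blockSum_of_flowSums hLT) hrem hr hup hβ' hβ₀ hL2 hr'

/-- **CUMULATIVE DEFECT × CONSTANT, Theorem-2 grade ⟹ THE CARRIER, DEFECT ZERO** — asym2's `betaLowerH_of_cumNearMarginConst` through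
`betaAvgAFH_of_betaLowerH`: `BetaAvgAFH (m − c₀θ^{k₁}(1+θ) − 2Γ − r) 0 γ₀ β` (`0 ≤ θ ≤ 1`, one-sided list `m ≤ a k` for `k ≤ k₁`; `2Γ` IN the slope —
here the defect is paid against the margin). [cite: Balaban1987RG1, (1.22) p.264 and (2.12)–(2.14) p.268] -/
theorem betaAvgAFH_of_cumNearMarginConst (S : B12Beta.OneLoopSplit β) {a : ℕ → ℝ} {γ₀ binf c₀ θ Γ r m : ℝ}
    {k₁ : ℕ} (hθ0 : 0 ≤ θ) (hθ1 : θ ≤ 1) (hconv : GeomRate a binf c₀ θ) (hlist : ∀ k, k ≤ k₁ → m ≤ a k)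
    (hcum : CumNear a S.β0 Γ) (hrem : RemainderConst S γ₀ r) :
    BetaAvgAFH (m - c₀ * θ ^ k₁ * (1 + θ) - 2 * Γ - r) 0 γ₀ β :=
  betaAvgAFH_of_betaLowerH (betaLowerH_of_cumNearMarginConst S hθ0 hθ1 hconv hlist hcum hrem)

/-- **CUMULATIVE DEFECT × CONSTANT, Theorem-2 grade ⟹ THE END STATEMENT, [III] SIDE, ALL PROFILES**: the binders of asym2's
`thm2Printed_of_cumNearMarginConst` minus `L`/`hL` (comparison rate, one-sided list, `CumNear a S.β0 Γ`, `RemainderConst` with the ONE condition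
`r < m − c₀θ^{k₁}(1+θ) − 2Γ` — `Γ` against the certified margin, (R19-3)'s certificate question —, (C), (U) with `β′ ≥ 0`) + the [III] run-side data.
[cite: Balaban1987RG1, Thm 2 p.259, (1.22) p.264 and Thm 3 p.264]
[cite: Balaban1988Convergent, (2.5)–(2.9) pp.255–256, (2.28) p.259, (2.46) p.263] -/
theorem cumNearMarginConst_END_allProfiles {C : B12.Construction} (hgen : ForwardGenerated C β)
    (hhalt : HaltsOutside C β) (hcur : CurriesHBeta C β) (S : B12Beta.OneLoopSplit β) {a : ℕ → ℝ}
    {γ₀ binf c₀ θ Γ r β' m : ℝ} {k₁ : ℕ} (hγ₀ : 0 < γ₀) (hθ0 : 0 ≤ θ) (hθ1 : θ ≤ 1) (hconv : GeomRate a binf c₀ θ)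
    (hlist : ∀ k, k ≤ k₁ → m ≤ a k) (hcum : CumNear a S.β0 Γ) (hrem : RemainderConst S γ₀ r)
    (hr : r < m - c₀ * θ ^ k₁ * (1 + θ) - 2 * Γ)
    (hcont : BetaContH γ₀ β) (hup : BetaUpperH β' γ₀ β) (hβ' : 0 ≤ β')
    {β₀ : ℝ} (hβ₀ : 0 < β₀) {L : ℕ} (hL2 : 2 ≤ L) (p : ℕ) {κ₀ : ℕ} (hκ : 6 ≤ κ₀) :
    EndpointExistence C ∧ ∃ γ₁ : ℝ, 0 < γ₁ ∧
      ∀ γ : ℝ, 0 < γ → γ ≤ min γ₀ γ₁ → ∀ Pr : B12.RunParams, (C Pr).flow.InInterval γ Pr.K →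
        ∀ p' : ℕ, p' ≤ p → ∀ A₀ : ℝ, 0 ≤ A₀ →
          ∃ Rj : ℕ → ℕ, (∀ j, B14.IsRj L p' ((C Pr).flow.g j) (Rj j)) ∧
            HorizonFacts (C Pr).flow β' β₀ A₀ L p' κ₀ Rj Pr.K :=
  (betaAvgAFH_of_cumNearMarginConst S hθ0 hθ1 hconv hlist hcum hrem).endpoint_and_flowControl_allProfiles
    (sub_pos.mpr hr) hgen hhalt hcur hγ₀ hβ' hβ₀ hL2 p hcont hup hκ

/-- **Non-vacuity with an OSCILLATING cumulative defect** (asym2's `RemainderConstCertified.Witness.cumNearConst_nonvacuous`: `|S.β0 k − a k| = 1/4`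
for every k — neither §5's equality nor §6's decay — while `CumNear a S.β0 (1/4)`): the END-grade drift carrier exists with slope `≥ 0` (what the
witness's END condition `r ≤ m − c₀θ^{k₁}` gives through `GeomRate.binf_ge`) AND the Theorem-2-grade defect-zero carrier with slope `> 0` (= 1/2).
[folklore] -/
theorem cumNearConst_carrier_nonvacuous :
    ∃ (β : HBeta) (γ₀ s D : ℝ), 0 < γ₀ ∧ 0 ≤ s ∧ BetaAvgAFH s D γ₀ β ∧ ∃ s' : ℝ, 0 < s' ∧ BetaAvgAFH s' 0 γ₀ β := by
  obtain ⟨β, S, a, k₁, γ₀, binf, c₀, θ, Γ, m, r, hγ₀, hθ0, hθ1, hconv, hcum, hlist, hrem, hr, hr', -⟩ :=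
    RemainderConstCertified.Witness.cumNearConst_nonvacuous
  exact ⟨β, γ₀, _, _, hγ₀, sub_nonneg.mpr (hr.trans (hconv.binf_ge (hlist k₁ le_rfl))),
    betaAvgAFH_of_cumNearConst S hθ0 hθ1 hconv hcum hrem, _, sub_pos.mpr hr',
    betaAvgAFH_of_cumNearMarginConst S hθ0 hθ1.le hconv hlist hcum hrem⟩

end CumulativeConst

/-! ## §8 (v1.4) The EVENTUAL RATE × CONSTANT road on the [III] side (asym1 `RateCertificate` v1.8 §12 `EvGeomRate`; asym2 `RemainderConstCertified`
v1.4 §11)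

asym1's §12 weakens the rate binder to an EVENTUAL one, `EvGeomRate b binf c₀ θ k₁ := ∀ k ≥ k₁, |b k − binf| ≤ c₀θ^k` — the located contraction is
owed from the threshold scale `k₁` on; below it the finitely many certified LOWER values are the only input (the «first-step exemption» of the
numerics rows; protocol v3 of `BETA/ASYM-beta.md` v1.8 §4‴: certify at `k = 0` AND `k = 1` at one `(N, L)`, the rate for `k ≥ 1` with the TAIL
constant) — and proves the SAME uniform floor `m − c₀θ^{k₁}(1+θ)` (`EvGeomRate.lower_of_list`).  asym2's §11 puts the constant remainder behind it
(`betaLowerH_of_evMarginConst`).  Here is the [III] side, exactly as in §4: the DEFECT-ZERO carrier by `betaAvgAFH_of_betaLowerH` (slope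
`m − c₀θ^{k₁}(1+θ) − r`, letter for letter §4's with `GeomRate S.β0 …` ↦ `EvGeomRate S.β0 … k₁`; §4 is the case of a full rate, `GeomRate.evGeomRate`,
kernel-checked below as an `example`) and the three consumers; the Cauchy form (`c₀ = c/(1−θ)`, `EvCauchyRate.evGeomRate`).  Binder census: `hconv`/`hrate`
asym1 — the EVENTUAL rate (LOCATED-UNPRINTED from the threshold, O-asym1-1); `hlist` cap (COMPUTATIONAL LEAVES, every `k ≤ k₁`, lower values only);
`hrem` (D4); `hcont` (C) (D5); `hup`/`hβ'` (U); `hgen`/`hhalt`/`hcur` structural / run-side.  [folklore]; nothing of the series is discharged; NOT Theorem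
2, NOT the wall, NOT continuum, NOT Clay. -/

section EventualConst

open Literature.MathematicalPhysics.QuantumFieldTheory.Balaban1983to89.Beta.RateCertificate (EvGeomRate EvCauchyRate)

/-- **EVENTUAL RATE × CONSTANT REMAINDER ⟹ THE CARRIER, DEFECT ZERO**: asym2's `betaLowerH_of_evMarginConst` through `betaAvgAFH_of_betaLowerH`:
`BetaAvgAFH (m − c₀θ^{k₁}(1+θ) − r) 0 γ₀ β` from `EvGeomRate S.β0 binf c₀ θ k₁` (`0 ≤ θ ≤ 1`, `binf` any real), the one-sided certified list
`m ≤ β⁰_{k+1}` for EVERY `k ≤ k₁` and `RemainderConst S γ₀ r`.  No (C), no upper bound, no DAG. [cite: Balaban1987RG1, (1.22) p.264 and (2.12)–(2.14) p.268] -/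
theorem betaAvgAFH_of_evMarginConst (S : B12Beta.OneLoopSplit β) {γ₀ binf c₀ θ r m : ℝ} {k₁ : ℕ} (hθ0 : 0 ≤ θ)
    (hθ1 : θ ≤ 1) (hconv : EvGeomRate S.β0 binf c₀ θ k₁) (hlist : ∀ k, k ≤ k₁ → m ≤ S.β0 k)
    (hrem : RemainderConst S γ₀ r) : BetaAvgAFH (m - c₀ * θ ^ k₁ * (1 + θ) - r) 0 γ₀ β :=
  betaAvgAFH_of_betaLowerH (betaLowerH_of_evMarginConst S hθ0 hθ1 hconv hlist hrem)

/-- **EVENTUAL RATE × CONSTANT REMAINDER ⟹ THE END STATEMENT, [III] SIDE, ALL PROFILES**: the binders of asym2's `thm2Printed_of_evMarginConst`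
minus `L`/`hL` (the eventual rate from the threshold `k₁`, the certified list for every `k ≤ k₁`, `RemainderConst` with the ONE condition
`r < m − c₀θ^{k₁}(1+θ)` STRICTLY, (C), (U) with `β′ ≥ 0`) + the [III] run-side data ⟹ `EndpointExistence C ∧ ∃ γ₁ > 0, ∀ γ ≤ min γ₀ γ₁, ∀ runs in
]0,γ], ∀ p′ ≤ p, ∀ A₀ ≥ 0: sizes ∧ HorizonFacts` ((2.6)–(2.9) + (2.46)), every `β₀ > 0`. [cite: Balaban1987RG1, Thm 2 p.259, (1.22) p.264 and Thm 3 p.264]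
[cite: Balaban1988Convergent, (2.5)–(2.9) pp.255–256, (2.28) p.259, (2.46) p.263] -/
theorem evMarginConst_END_allProfiles {C : B12.Construction} (hgen : ForwardGenerated C β)
    (hhalt : HaltsOutside C β) (hcur : CurriesHBeta C β) (S : B12Beta.OneLoopSplit β)
    {γ₀ binf c₀ θ r β' m : ℝ} {k₁ : ℕ} (hγ₀ : 0 < γ₀) (hθ0 : 0 ≤ θ) (hθ1 : θ ≤ 1)
    (hconv : EvGeomRate S.β0 binf c₀ θ k₁) (hlist : ∀ k, k ≤ k₁ → m ≤ S.β0 k) (hrem : RemainderConst S γ₀ r)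
    (hr : r < m - c₀ * θ ^ k₁ * (1 + θ))
    (hcont : BetaContH γ₀ β) (hup : BetaUpperH β' γ₀ β) (hβ' : 0 ≤ β')
    {β₀ : ℝ} (hβ₀ : 0 < β₀) {L : ℕ} (hL2 : 2 ≤ L) (p : ℕ) {κ₀ : ℕ} (hκ : 6 ≤ κ₀) :
    EndpointExistence C ∧ ∃ γ₁ : ℝ, 0 < γ₁ ∧
      ∀ γ : ℝ, 0 < γ → γ ≤ min γ₀ γ₁ → ∀ Pr : B12.RunParams, (C Pr).flow.InInterval γ Pr.K →
        ∀ p' : ℕ, p' ≤ p → ∀ A₀ : ℝ, 0 ≤ A₀ →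
          ∃ Rj : ℕ → ℕ, (∀ j, B14.IsRj L p' ((C Pr).flow.g j) (Rj j)) ∧
            HorizonFacts (C Pr).flow β' β₀ A₀ L p' κ₀ Rj Pr.K :=
  (betaAvgAFH_of_evMarginConst S hθ0 hθ1 hconv hlist hrem).endpoint_and_flowControl_allProfiles
    (sub_pos.mpr hr) hgen hhalt hcur hγ₀ hβ' hβ₀ hL2 p hcont hup hκ

/-- **EVENTUAL RATE × CONSTANT REMAINDER AT SLOPE ≥ 0 ⟹ (2.6)–(2.9) FOR ALL PROFILES, WITHOUT (2.46)** (`r ≤ …`; NO continuity).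
[cite: Balaban1988Convergent, (2.5)–(2.9) pp.255–256] -/
theorem evMarginConst_flowIneq_allProfiles {C : B12.Construction} (hgen : ForwardGenerated C β)
    (hhalt : HaltsOutside C β) (hcur : CurriesHBeta C β) (S : B12Beta.OneLoopSplit β)
    {γ₀ binf c₀ θ r β' m : ℝ} {k₁ : ℕ} (hγ₀ : 0 < γ₀) (hθ0 : 0 ≤ θ) (hθ1 : θ ≤ 1)
    (hconv : EvGeomRate S.β0 binf c₀ θ k₁) (hlist : ∀ k, k ≤ k₁ → m ≤ S.β0 k) (hrem : RemainderConst S γ₀ r)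
    (hr : r ≤ m - c₀ * θ ^ k₁ * (1 + θ))
    (hup : BetaUpperH β' γ₀ β) (hβ' : 0 ≤ β') {β₀ : ℝ} (hβ₀ : 0 < β₀) {L : ℕ} (hL2 : 2 ≤ L) (p : ℕ) :
    ∃ γ₁ : ℝ, 0 < γ₁ ∧
      ∀ γ : ℝ, 0 < γ → γ ≤ min γ₀ γ₁ → ∀ Pr : B12.RunParams, (C Pr).flow.InInterval γ Pr.K →
        ∀ p' : ℕ, p' ≤ p → ∀ A₀ : ℝ, 0 ≤ A₀ →
          ∃ Rj : ℕ → ℕ, (∀ j, B14.IsRj L p' ((C Pr).flow.g j) (Rj j)) ∧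
            B14.FlowIneq26 (C Pr).flow.g β' β₀ Pr.K ∧ B14.FlowIneq27 (C Pr).flow.g β' β₀ p' Pr.K ∧
            B14.FlowIneq28 (epsK A₀ p' (C Pr).flow) (C Pr).flow.g β' β₀ Pr.K ∧
            B14FlowStep.FlowIneq29 Rj (C Pr).flow.g L β' β₀ Pr.K :=
  (betaAvgAFH_of_evMarginConst S hθ0 hθ1 hconv hlist hrem).flowIneq_allProfiles (sub_nonneg.mpr hr) hgen
    hhalt hcur hγ₀ hβ' hβ₀ hL2 p hup

/-- **EVENTUAL RATE × CONSTANT REMAINDER AT SLOPE ≥ 0 ⟹ THE T⁴ CELL's FLOW-FACT BINDERS** (C19/C20; NO continuity).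
[cite: Balaban1988Convergent, (2.5)–(2.9) pp.255–256] -/
theorem evMarginConst_t4FlowInputs {C : B12.Construction} (hgen : ForwardGenerated C β)
    (hhalt : HaltsOutside C β) (hcur : CurriesHBeta C β) (S : B12Beta.OneLoopSplit β)
    {γ₀ binf c₀ θ r β' m : ℝ} {k₁ : ℕ} (hγ₀ : 0 < γ₀) (hθ0 : 0 ≤ θ) (hθ1 : θ ≤ 1)
    (hconv : EvGeomRate S.β0 binf c₀ θ k₁) (hlist : ∀ k, k ≤ k₁ → m ≤ S.β0 k) (hrem : RemainderConst S γ₀ r)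
    (hr : r ≤ m - c₀ * θ ^ k₁ * (1 + θ))
    (hup : BetaUpperH β' γ₀ β) (hβ' : 0 ≤ β') {β₀ : ℝ} (hβ₀ : 0 < β₀) {L : ℕ} (hL2 : 2 ≤ L) {p₀ r' : ℕ}
    (hr' : r' ≤ p₀) :
    ∃ γ₁ : ℝ, 0 < γ₁ ∧ ∀ γ : ℝ, 0 < γ → γ ≤ min γ₀ γ₁ → ∀ Pr : B12.RunParams, (C Pr).flow.InInterval γ Pr.K →
      B14.FlowIneq27 (C Pr).flow.g β' β₀ p₀ Pr.K ∧
      (∀ j, j ≤ Pr.K → 1 ≤ Real.log (((C Pr).flow.g j) ^ 2)⁻¹) ∧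
      ∃ Rj : ℕ → ℕ, (∀ j, B14.IsRj L r' ((C Pr).flow.g j) (Rj j)) ∧ B14FlowStep.FlowIneq29 Rj (C Pr).flow.g L β' β₀ Pr.K :=
  (betaAvgAFH_of_evMarginConst S hθ0 hθ1 hconv hlist hrem).t4FlowInputs_of_nonneg (sub_nonneg.mpr hr) hgen
    hhalt hcur hγ₀ hβ' hβ₀ hL2 hr' hup

/-- **… from the EVENTUAL CAUCHY shape** (`c₀ = c/(1−θ)`, `θ < 1`; the constructed limit never appears; the rate is owed for `k ≥ k₁` only;
`EvCauchyRate.evGeomRate`) — the [III]-side twin of asym2's `thm2Printed_of_evCauchyMarginConst`. [cite: Balaban1987RG1, Thm 2 p.259, (1.22) p.264 and Thm 3 p.264]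
[cite: Balaban1988Convergent, (2.5)–(2.9) pp.255–256, (2.28) p.259, (2.46) p.263] -/
theorem evCauchyMarginConst_END_allProfiles {C : B12.Construction} (hgen : ForwardGenerated C β)
    (hhalt : HaltsOutside C β) (hcur : CurriesHBeta C β) (S : B12Beta.OneLoopSplit β)
    {γ₀ c θ r β' m : ℝ} {k₁ : ℕ} (hγ₀ : 0 < γ₀) (hθ0 : 0 ≤ θ) (hθ1 : θ < 1)
    (hrate : EvCauchyRate S.β0 c θ k₁) (hlist : ∀ k, k ≤ k₁ → m ≤ S.β0 k) (hrem : RemainderConst S γ₀ r)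
    (hr : r < m - c / (1 - θ) * θ ^ k₁ * (1 + θ))
    (hcont : BetaContH γ₀ β) (hup : BetaUpperH β' γ₀ β) (hβ' : 0 ≤ β')
    {β₀ : ℝ} (hβ₀ : 0 < β₀) {L : ℕ} (hL2 : 2 ≤ L) (p : ℕ) {κ₀ : ℕ} (hκ : 6 ≤ κ₀) :
    EndpointExistence C ∧ ∃ γ₁ : ℝ, 0 < γ₁ ∧
      ∀ γ : ℝ, 0 < γ → γ ≤ min γ₀ γ₁ → ∀ Pr : B12.RunParams, (C Pr).flow.InInterval γ Pr.K →
        ∀ p' : ℕ, p' ≤ p → ∀ A₀ : ℝ, 0 ≤ A₀ →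
          ∃ Rj : ℕ → ℕ, (∀ j, B14.IsRj L p' ((C Pr).flow.g j) (Rj j)) ∧
            HorizonFacts (C Pr).flow β' β₀ A₀ L p' κ₀ Rj Pr.K :=
  evMarginConst_END_allProfiles hgen hhalt hcur S hγ₀ hθ0 hθ1.le (hrate.evGeomRate hθ1) hlist hrem hr hcont hup hβ'
    hβ₀ hL2 p hκ

/- NOTHING IS LOST (kernel check, not a new declaration): §4's `betaAvgAFH_of_marginConst` is the case of the full `GeomRate`
(`GeomRate.evGeomRate`). -/
example (S : B12Beta.OneLoopSplit β) {γ₀ binf c₀ θ r m : ℝ} {k₁ : ℕ} (hθ0 : 0 ≤ θ) (hθ1 : θ ≤ 1)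
    (hconv : GeomRate S.β0 binf c₀ θ) (hlist : ∀ k, k ≤ k₁ → m ≤ S.β0 k) (hrem : RemainderConst S γ₀ r) :
    BetaAvgAFH (m - c₀ * θ ^ k₁ * (1 + θ) - r) 0 γ₀ β :=
  betaAvgAFH_of_evMarginConst S hθ0 hθ1 (hconv.evGeomRate k₁) hlist hrem

/-- **Non-vacuity with a POSITIVE slope and NO rate below the threshold** (asym2's `RemainderConstCertified.Witness.evMarginConst_nonvacuous`:
`EvGeomRate β⁰ 1 0 0 1` while `¬ GeomRate β⁰ 1 0 0`): the eventual road's defect-zero carrier exists with `0 < slope` (= 1). [folklore] -/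
theorem evMarginConst_carrier_nonvacuous :
    ∃ (β : HBeta) (γ₀ s : ℝ), 0 < γ₀ ∧ 0 < s ∧ BetaAvgAFH s 0 γ₀ β := by
  obtain ⟨β, S, k₁, γ₀, binf, c₀, θ, m, r, hγ₀, hθ0, hθ1, hconv, hlist, hrem, hr, -⟩ :=
    RemainderConstCertified.Witness.evMarginConst_nonvacuous
  exact ⟨β, γ₀, _, hγ₀, sub_pos.mpr hr, betaAvgAFH_of_evMarginConst S hθ0 hθ1 hconv hlist hrem⟩

end EventualConst

end

end Literature.MathematicalPhysics.QuantumFieldTheory.Balaban1983to89.Beta.AveragedAFCarrierCertified
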